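import Literature.Analysis.FluidPDE.EnstrophySplitting
import Literature.Analysis.FluidPDE.LerayHopfH1Test
import HarnessLib

/-!
# Serrin's enstrophy inequality `‖∇u(t)‖² ≤ ‖∇u(0)‖² exp(C ν^{1-q} ∫₀ᵗ ‖u‖_{L^r}^q)` for smooth solutions

Analysis/FluidPDE proof file (no named facts). It is the a-priori estimate of the
Ladyzhenskaya–Prodi–Serrin programme (decomposition of **ns.S07**
`Literature.Analysis.FluidPDE.ladyzhenskaya_prodi_serrin`, see `NSSerrinRegularity.lean`): the
differential inequality behind Serrin's criterion as printed by Lemarié-Rieusset 2016, Thm. 11.2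
with (11.9)–(11.11) (PDF pp. 338–339 of the held copy),

  `d/dt ‖∇u‖²₂ ≤ C₀ ν^{1-q} ‖u‖_{L^r}^q ‖∇u‖²₂`,  `2/q + 3/r = 1`, `3 < r ≤ ∞`, `2 ≤ q < ∞`,

followed by Grönwall's lemma,

  `‖∇u(s)‖²₂ ≤ ‖∇u(0)‖²₂ exp (C₀ ν^{1-q} ∫₀ˢ ‖u(t)‖_{L^r}^q dt)`      (LR (11.11), `f = 0`),

which is also the computation in the proof of Robinson–Rodrigo–Sadowski 2016, Lemma 8.16
(PDF pp. 130–131). It is proved here (`serrin_enstrophy_le_mul_exp`, packaged with an existential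
constant in `serrin_enstrophy_bound`) for classical solutions of the unforced system on a closed
slab `[0, T] × ℝ³` in the `L²`-Sobolev class of Tao's smooth `H¹` theory (`u, ∂ₜu, p ∈ L^∞_t H^k_x`,
the hypotheses of the tree's `EnstrophyGronwall.lean`, which is the case `(q, r) = (2, ∞)` under a
*uniform* bound `|u| ≤ M`; here the coefficient `‖u(t)‖_{L^r}^q` is only integrable in time).

## The computation (one time slice, `v = u(t)`, `W = ∂ₜu(t)`, `vⱼ = ∂ⱼv`; LR (11.9))

1. `∫ Σᵢ ⟪∂ᵢv, ∂ᵢW⟫ = -∫ ⟪Δv, W⟫ = -ν‖Δv‖²₂ + ∫ ⟪Δv, (v·∇)v⟫ + ∫ ⟪Δv, ∇p⟫`, the pressure term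
   vanishing since `div Δv = 0` (as in `EnstrophySplitting.lean`);
2. `⟪Δv, (v·∇)v⟫ ≤ (ν/2)|Δv|² + (2ν)⁻¹ |v|² ‖Dv‖²` and `‖Dv‖² ≤ Σⱼ |vⱼ|²` pointwise;
3. for each `j` (`3 < r < ∞`, `θ = 1 - 3/r`, `m = 2r/(r-2)`): Hölder `(r/2, m/2)`,
   `∫ |v|²|vⱼ|² ≤ ‖v‖_r² ‖vⱼ‖_m²`, Lebesgue interpolation `‖vⱼ‖_m ≤ ‖vⱼ‖₂^θ ‖vⱼ‖₆^{1-θ}`, the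
   Sobolev inequality `‖vⱼ‖₆ ≤ K ‖Dvⱼ‖₂` and `‖Dvⱼ‖²₂ ≤ Rⱼ := Σᵢ ‖∂ᵢvⱼ‖²₂`, so that
   `∫ |v|²|vⱼ|² ≤ ‖v‖_r² aⱼ^θ (K² Rⱼ)^{1-θ}`, `aⱼ = ‖vⱼ‖²₂` (`integral_sq_norm_mul_norm_fderiv_apply_le`);
4. Young's inequality with the weights `(1-θ, θ)` absorbs `Rⱼ^{1-θ}` into the dissipation:
   `(2ν)⁻¹ ∫|v|²|vⱼ|² ≤ (ν/2) Rⱼ + C(θ) ν^{1-2/θ} ‖v‖_r^{2/θ} aⱼ` (`serrin_absorb_component`), with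
   `q = 2/θ = 2r/(r-3)` and `1 - 2/θ = 1 - q`; summing over `j` and using the Hessian–Laplacian
   identity `Σⱼ Rⱼ = ‖Δv‖²₂` (`EnstrophySplitting.lean`) the dissipation cancels exactly:
   `∫ Σᵢ ⟪∂ᵢv, ∂ᵢW⟫ ≤ C ν^{1-q} ‖v‖_r^q ∫ |∇v|²` (`integral_sum_inner_fderiv_le_of_momentum_of_eLpNorm`;
   at the endpoint `r = ∞`, `θ = 1`, steps 3–4 reduce to `|v| ≤ ‖v‖_∞` and `C = 1/2`);
5. on the slab, `G(t) = ∫ |∇u(t)|²` satisfies `G(b) - G(0) = ∫₀ᵇ 2∫ Σᵢ⟪∂ᵢu, ∂ᵢ∂ₜu⟫`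
   (`IsSmoothSpaceTimeOn.enstrophy_balance`: pointwise `d/dt |∇u|² = 2Σᵢ⟪∂ᵢu, ∂ᵢ∂ₜu⟫`, FTC in `t`
   and Fubini, the identity used inline in `EnstrophyGronwall.lean` / `EnstrophySplitting.lean`,
   isolated here), and the integral form of Grönwall's lemma with an `L¹` kernel
   (`lintegral_gronwall_le`, Robinson–Rodrigo–Sadowski 2016, Lemma A.25 with constant `a`, proved by a
   step-partition argument in `ℝ≥0∞` without measurability or continuity assumptions) concludes.

The constant is explicit: `C(θ) = θ (2(1-θ))^{(1-θ)/θ} 2^{-1/θ} K^{2(1-θ)/θ}`, `K` the Sobolev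
constant of `‖w‖_{L⁶} ≤ K‖Dw‖_{L²}` (Mathlib `SNormLESNormFDerivOfEqConst`), and the bound on the
slab carries `2 C(θ)`. The time integral `∫₀ˢ ‖u(t)‖_r^q dt` is written as the lower integral of
`ENNReal.ofReal ((eLpNorm (u t) r).toReal ^ q)`, the integrand convention of the tree's mixed classes
`MemLqLp` (inner norm through `toReal`); in the Tao class every slice is bounded and in `L²`, hence in
`L^r`, so no junk value occurs.

## Mathlib / tree search

Grönwall: Mathlib has only constant coefficients (`gronwallBound`, `norm_le_gronwallBound_of_norm_deriv_right_le`);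
the tree has `bootstrap_gronwall(_integral)` (constant `κ`, `TaoEnstrophyContinuity.lean`) and the
null-conclusion `L¹`-kernel version `lintegral_gronwall_eq_zero` (`NSWeakStrongUniqueness.lean`),
whose step-partition argument is adapted here to the inhomogeneous case. Interpolation:
`lintegral_rpow_interpolate` (`LerayHopfH1Test.lean`); Hölder: Mathlib
`ENNReal.lintegral_mul_le_Lp_mul_Lq`; weighted AM–GM: Mathlib `Real.geom_mean_le_arith_mean2_weighted`;
Sobolev `H¹ ⊂ L⁶`: `eLpNorm_six_le_eLpNorm_fderiv_two` (`SobolevWholeSpace.lean`); `L^∞` bound of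
the Tao class: `linfty_bound_of_hasBoundedSobolevNormsOn_holds` (`TaoLocalisationProofs.lean`).

## References

* P. G. Lemarié-Rieusset, *The Navier–Stokes Problem in the 21st Century*, CRC Press (2016),
  §11.3, Thm. 11.2, (11.9)–(11.11) (PDF pp. 338–339 of doi:10.1201/b19556). [LemarieRieusset2016]
* J. C. Robinson, J. L. Rodrigo, W. Sadowski, *The Three-Dimensional Navier–Stokes Equations.
  Classical theory*, CUP (2016), Lemma 8.16 (proof, PDF pp. 130–131), Lemma A.25 (PDF p. 282),
  Thm. 1.5 (Lebesgue interpolation). [RobinsonRodrigoSadowski2016]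
* J. Serrin, *The initial value problem for the Navier–Stokes equations*, in: Nonlinear Problems
  (Madison 1962), 69–98 (1963), §4. [Serrin1963]
-/

noncomputable section

open MeasureTheory Set Function Filter Topology InnerProductSpace
open scoped ENNReal NNReal ContDiff RealInnerProductSpace Laplacian

namespace Literature.Analysis.FluidPDE

/-! ### Grönwall's lemma in integral form with an `L¹` kernel -/

section Gronwall

/-- `1/(1-η) ≤ exp((1+δ)η)` for `0 ≤ η ≤ δ/(1+δ)`, `η < 1` (from `exp x ≥ 1 + x`). [folklore] -/
theorem one_div_sub_le_exp {δ η : ℝ} (hδ : 0 < δ) (hη0 : 0 ≤ η) (hη : η ≤ δ / (1 + δ))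
    (hη1 : η < 1) : 1 / (1 - η) ≤ Real.exp ((1 + δ) * η) := by
  rw [div_le_iff₀ (by linarith)]
  have h1 : 1 + (1 + δ) * η ≤ Real.exp ((1 + δ) * η) := Real.add_one_le_exp _ |>.trans_eq' (by ring)
  have h2 : (1 + δ) * η ≤ δ := by rwa [le_div_iff₀ (by linarith), mul_comm] at hη
  nlinarith [h1, h2, Real.exp_pos ((1 + δ) * η)]

/-- Additivity of the lower integral over adjacent half-open intervals. [folklore] -/
theorem lintegral_Ioc_add_Ioc {a b c : ℝ} (hab : a ≤ b) (hbc : b ≤ c) (f : ℝ → ℝ≥0∞) :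
    ∫⁻ t in Ioc a c, f t = (∫⁻ t in Ioc a b, f t) + ∫⁻ t in Ioc b c, f t := by
  rw [← Ioc_union_Ioc_eq_Ioc hab hbc, lintegral_union measurableSet_Ioc]
  exact Ioc_disjoint_Ioc_of_le le_rfl

/-- The lower integral over `(a, b)` equals that over `(a, b]` (Lebesgue measure). [folklore] -/
theorem lintegral_Ioo_eq_lintegral_Ioc (a b : ℝ) (f : ℝ → ℝ≥0∞) :
    ∫⁻ t in Ioo a b, f t = ∫⁻ t in Ioc a b, f t :=
  setLIntegral_congr Ioo_ae_eq_Ioc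

/-- One step of the partition argument, in reals: if `m ≤ b + e m` with `0 ≤ e ≤ η < 1` and
`η ≤ δ/(1+δ)`, then `b + e m ≤ b exp((1+δ) e)`. [folklore] -/
theorem gronwall_step_real {b m e δ η : ℝ} (hb : 0 ≤ b) (he0 : 0 ≤ e) (heη : e ≤ η)
    (hδ : 0 < δ) (hη : η ≤ δ / (1 + δ)) (hη1 : η < 1) (hstep : m ≤ b + e * m) :
    b + e * m ≤ b * Real.exp ((1 + δ) * e) := by
  have he1 : e < 1 := lt_of_le_of_lt heη hη1
  have hm' : m * (1 - e) ≤ b := by nlinarith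
  have hm'' : m ≤ b / (1 - e) := by rwa [le_div_iff₀ (by linarith)]
  have hexp : 1 / (1 - e) ≤ Real.exp ((1 + δ) * e) :=
    one_div_sub_le_exp hδ he0 (heη.trans hη) he1
  calc b + e * m ≤ b + e * (b / (1 - e)) := by gcongr
    _ = b * (1 / (1 - e)) := by
        have : (1 - e) ≠ 0 := by linarith
        field_simp
        ring
    _ ≤ b * Real.exp ((1 + δ) * e) := by gcongr

/-- **Grönwall's lemma in integral form with an integrable kernel** (Robinson–Rodrigo–Sadowski
2016, Lemma A.25, the case of a constant `a ≡ B`: "`η(t) ≤ a + ∫₀ᵗ φ η` ⟹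
`η(t) ≤ a exp ∫₀ᵗ φ`"). Stated for `ℝ≥0∞`-valued `φ` and kernel `a` and lower integrals, with
**no measurability or continuity** assumed: `φ` bounded by `M < ∞` on `[0, S]`, `∫₀^S a < ∞`,
`B < ∞`, and `φ(t) ≤ B + ∫_{(0,t)} a φ` for every `t ∈ [0, S]` imply
`φ(t) ≤ B exp(∫_{(0,t)} a)` for every `t ∈ [0, S]`.
Proof: for `δ > 0` fix `η ≤ δ/(1+δ)`, `η ≤ 1/2`, and partition `(0, t]` into `N` steps so short
that `∫_{step} a < η` (absolute continuity of the lower integral,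
`exists_pos_setLIntegral_lt_of_measure_lt`); with `B_k = B + ∫_{(0,t_k]} a φ` one shows inductively
`B_k ≤ B exp((1+δ) ∫_{(0,t_k]} a)` (on the `k`-th step `sup φ ≤ B_{k-1} + e_k sup φ`,
`e_k = ∫_{step} a`, whence `B_k ≤ B_{k-1}/(1-e_k) ≤ B_{k-1} exp((1+δ)e_k)`), so
`φ(t) ≤ B_N ≤ B exp((1+δ)∫_{(0,t)} a)`; let `δ → 0`. [cite: RobinsonRodrigoSadowski2016, Lemma A.25] -/
theorem lintegral_gronwall_le {S : ℝ} {φ a : ℝ → ℝ≥0∞} {B M : ℝ≥0∞} (hB : B ≠ ⊤) (hM : M ≠ ⊤)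
    (hφM : ∀ t ∈ Icc 0 S, φ t ≤ M) (ha : ∫⁻ t in Ioo 0 S, a t ≠ ⊤)
    (hφ : ∀ t ∈ Icc 0 S, φ t ≤ B + ∫⁻ s in Ioo 0 t, a s * φ s) :
    ∀ t ∈ Icc 0 S, φ t ≤ B * ENNReal.ofReal (Real.exp (∫⁻ s in Ioo 0 t, a s).toReal) := by
  intro t ht
  rcases eq_or_lt_of_le ht.1 with h0 | ht0
  · -- `t = 0`
    have := hφ t ht
    rw [← h0] at this ⊢
    simp only [Ioo_self, Measure.restrict_empty, lintegral_zero_measure, add_zero,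
      ENNReal.toReal_zero, Real.exp_zero, ENNReal.ofReal_one, mul_one] at this ⊢
    exact this
  -- finiteness of the kernel integral up to `t`
  have hat : ∫⁻ s in Ioo 0 t, a s ≠ ⊤ :=
    ne_top_of_le_ne_top ha (lintegral_mono_set (Ioo_subset_Ioo le_rfl ht.2))
  -- reduce to `(1 + δ)` in the exponent
  suffices hδ : ∀ δ : ℝ, 0 < δ →
      φ t ≤ B * ENNReal.ofReal (Real.exp ((1 + δ) * (∫⁻ s in Ioo 0 t, a s).toReal)) by
    refine ge_of_tendsto (f := fun δ : ℝ =>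
      B * ENNReal.ofReal (Real.exp ((1 + δ) * (∫⁻ s in Ioo 0 t, a s).toReal)))
      (x := 𝓝[>] (0 : ℝ)) ?_ ?_
    · have hc : Continuous fun δ : ℝ =>
          ENNReal.ofReal (Real.exp ((1 + δ) * (∫⁻ s in Ioo 0 t, a s).toReal)) :=
        ENNReal.continuous_ofReal.comp (Real.continuous_exp.comp
          ((continuous_const.add continuous_id).mul continuous_const))
      have h1 := ((hc.tendsto 0).mono_left (nhdsWithin_le_nhds (s := Ioi (0 : ℝ))))
      simp only [add_zero, one_mul] at h1
      exact ENNReal.Tendsto.const_mul h1 (Or.inr hB)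
    · filter_upwards [self_mem_nhdsWithin] with δ hδ' using hδ δ hδ'
  intro δ hδ
  -- the smallness threshold `η`
  set η : ℝ := min (1 / 2) (δ / (1 + δ)) with hηdef
  have hη0 : 0 < η := lt_min (by norm_num) (div_pos hδ (by linarith))
  have hη1 : η < 1 := (min_le_left _ _).trans_lt (by norm_num)
  have hηδ : η ≤ δ / (1 + δ) := min_le_right _ _
  -- absolute continuity of `∫ a` on `(0, S)`
  set μ : Measure ℝ := volume.restrict (Ioo 0 S) with hμ
  have hε0 : ENNReal.ofReal η ≠ 0 := (ENNReal.ofReal_pos.2 hη0).ne'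
  obtain ⟨δ', hδ'0, hδ'⟩ := exists_pos_setLIntegral_lt_of_measure_lt (μ := μ) ha hε0
  obtain ⟨h, hh0, hhδ⟩ : ∃ h : ℝ, 0 < h ∧ ENNReal.ofReal h < δ' := by
    rcases eq_or_ne δ' ⊤ with hδ | hδ
    · exact ⟨1, one_pos, by simp [hδ]⟩
    · refine ⟨δ'.toReal / 2, half_pos (ENNReal.toReal_pos hδ'0.ne' hδ), ?_⟩
      calc ENNReal.ofReal (δ'.toReal / 2) < ENNReal.ofReal δ'.toReal :=
            (ENNReal.ofReal_lt_ofReal_iff (ENNReal.toReal_pos hδ'0.ne' hδ)).2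
              (half_lt_self (ENNReal.toReal_pos hδ'0.ne' hδ))
        _ = δ' := ENNReal.ofReal_toReal hδ
  -- the partition `t_k = k t / N` with `t / N ≤ h`
  obtain ⟨N, hN⟩ := exists_nat_gt (t / h)
  have hNpos : 0 < (N : ℝ) := lt_trans (div_pos ht0 hh0) hN
  have hN0 : N ≠ 0 := by rintro rfl; simp at hNpos
  set τ : ℕ → ℝ := fun k => k * (t / N) with hτ
  have hτ0 : τ 0 = 0 := by simp [hτ]
  have hτN : τ N = t := by simp [hτ]; field_simp
  have hτmono : ∀ k, τ k ≤ τ (k + 1) := fun k => by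
    simp only [hτ]; push_cast; nlinarith [div_pos ht0 hNpos]
  have hτnn : ∀ k, 0 ≤ τ k := fun k => by positivity
  have hτle : ∀ k, k ≤ N → τ k ≤ t := fun k hk => by
    calc τ k ≤ τ N := by
          simp only [hτ]; gcongr
      _ = t := hτN
  have hstep_small : ∀ k, k + 1 ≤ N → ∫⁻ s in Ioc (τ k) (τ (k + 1)), a s < ENNReal.ofReal η := by
    intro k hk
    have hsub : Ioc (τ k) (τ (k + 1)) ⊆ Ioc 0 S := fun s hs =>
      ⟨(hτnn k).trans_lt hs.1, hs.2.trans ((hτle (k + 1) hk).trans ht.2)⟩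
    have hmeas : μ (Ioo (τ k) (τ (k + 1))) < δ' := by
      calc μ (Ioo (τ k) (τ (k + 1))) ≤ volume (Ioo (τ k) (τ (k + 1))) := Measure.restrict_apply_le _ _
        _ = ENNReal.ofReal (τ (k + 1) - τ k) := Real.volume_Ioo
        _ = ENNReal.ofReal (t / N) := by congr 1; simp only [hτ]; push_cast; ring
        _ ≤ ENNReal.ofReal h := ENNReal.ofReal_le_ofReal (by
            rw [div_le_iff₀ hNpos]; rw [div_lt_iff₀ hh0] at hN; linarith)
        _ < δ' := hhδ
    have := hδ' _ hmeas
    rw [hμ, Measure.restrict_restrict measurableSet_Ioo, inter_eq_left.2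
      (Ioo_subset_Ioo (le_refl 0) ((hτle (k+1) hk).trans ht.2) |>.trans' (Ioo_subset_Ioo (hτnn k) le_rfl))] at this
    rwa [← lintegral_Ioo_eq_lintegral_Ioc]
  -- conversions between `Ioo` and `Ioc`
  have hφ' : ∀ s ∈ Icc 0 S, φ s ≤ B + ∫⁻ σ in Ioc 0 s, a σ * φ σ := fun s hs => by
    rw [← lintegral_Ioo_eq_lintegral_Ioc]; exact hφ s hs
  have haS : ∀ c, c ≤ S → ∫⁻ σ in Ioc 0 c, a σ ≤ ∫⁻ σ in Ioo 0 S, a σ := fun c hc => by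
    rw [← lintegral_Ioo_eq_lintegral_Ioc]; exact lintegral_mono_set (Ioo_subset_Ioo le_rfl hc)
  have haφ_fin : ∀ c, c ≤ S → ∫⁻ σ in Ioc 0 c, a σ * φ σ ≠ ⊤ := by
    intro c hc
    refine ne_top_of_le_ne_top (ENNReal.mul_ne_top ha hM) ?_
    calc ∫⁻ σ in Ioc 0 c, a σ * φ σ ≤ ∫⁻ σ in Ioc 0 c, a σ * M := by
          refine setLIntegral_mono' measurableSet_Ioc fun σ hσ => ?_
          exact mul_le_mul_right (hφM σ ⟨hσ.1.le, hσ.2.trans hc⟩) _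
      _ = (∫⁻ σ in Ioc 0 c, a σ) * M := lintegral_mul_const' _ _ hM
      _ ≤ (∫⁻ σ in Ioo 0 S, a σ) * M := mul_le_mul_left (haS c hc) _
  -- the partial quantities `B_k`, `A_k`
  set Bk : ℕ → ℝ≥0∞ := fun k => B + ∫⁻ σ in Ioc 0 (τ k), a σ * φ σ with hBk
  set Ak : ℕ → ℝ≥0∞ := fun k => ∫⁻ σ in Ioc 0 (τ k), a σ with hAk
  have hBk_fin : ∀ k, k ≤ N → Bk k ≠ ⊤ := fun k hk =>
    ENNReal.add_ne_top.2 ⟨hB, haφ_fin _ ((hτle k hk).trans ht.2)⟩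
  have hAk_fin : ∀ k, k ≤ N → Ak k ≠ ⊤ := fun k hk =>
    ne_top_of_le_ne_top ha (haS _ ((hτle k hk).trans ht.2))
  -- the induction
  have key : ∀ k, k ≤ N → Bk k ≤ B * ENNReal.ofReal (Real.exp ((1 + δ) * (Ak k).toReal)) := by
    intro k
    induction k with
    | zero =>
      intro _
      simp [hBk, hAk, hτ0]
    | succ k ih =>
      intro hk
      have hk' : k ≤ N := (Nat.le_succ k).trans hk
      have IH := ih hk'
      set I : Set ℝ := Ioc (τ k) (τ (k + 1)) with hI
      have hIsub : I ⊆ Icc 0 S := fun s hs =>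
        ⟨(hτnn k).trans hs.1.le, hs.2.trans ((hτle (k + 1) hk).trans ht.2)⟩
      set ek : ℝ≥0∞ := ∫⁻ σ in I, a σ with hek
      have hek_lt : ek < ENNReal.ofReal η := hstep_small k hk
      have hek_fin : ek ≠ ⊤ := (hek_lt.trans ENNReal.ofReal_lt_top).ne
      set Mk : ℝ≥0∞ := ⨆ (s : ℝ) (_ : s ∈ I), φ s with hMk
      have hMkM : Mk ≤ M := iSup₂_le fun s hs => hφM s (hIsub hs)
      have hMk_fin : Mk ≠ ⊤ := ne_top_of_le_ne_top hM hMkM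
      -- `∫_I a φ ≤ ek Mk`
      have hIaφ : ∫⁻ σ in I, a σ * φ σ ≤ ek * Mk := by
        calc ∫⁻ σ in I, a σ * φ σ ≤ ∫⁻ σ in I, a σ * Mk := by
              refine setLIntegral_mono' measurableSet_Ioc fun σ hσ => ?_
              exact mul_le_mul_right (le_iSup₂ (f := fun (s : ℝ) (_ : s ∈ I) => φ s) σ hσ) _
          _ = ek * Mk := lintegral_mul_const' _ _ hMk_fin
      -- `φ s ≤ B_k + ek Mk` on the step, hence `Mk ≤ B_k + ek Mk`
      have hstep : ∀ s ∈ I, φ s ≤ Bk k + ek * Mk := by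
        intro s hs
        calc φ s ≤ B + ∫⁻ σ in Ioc 0 s, a σ * φ σ := hφ' s (hIsub hs)
          _ = B + ((∫⁻ σ in Ioc 0 (τ k), a σ * φ σ) + ∫⁻ σ in Ioc (τ k) s, a σ * φ σ) := by
              rw [lintegral_Ioc_add_Ioc (hτnn k) hs.1.le]
          _ ≤ B + ((∫⁻ σ in Ioc 0 (τ k), a σ * φ σ) + ∫⁻ σ in I, a σ * φ σ) := by
              gcongr B + (_ + ?_)
              exact lintegral_mono_set (Ioc_subset_Ioc le_rfl hs.2)
          _ = Bk k + ∫⁻ σ in I, a σ * φ σ := by rw [hBk, add_assoc]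
          _ ≤ Bk k + ek * Mk := by gcongr
      have hMkle : Mk ≤ Bk k + ek * Mk := iSup₂_le hstep
      -- pass to reals
      set b : ℝ := (Bk k).toReal with hb
      set m : ℝ := Mk.toReal with hm
      set e : ℝ := ek.toReal with he
      have heη : e ≤ η := by
        rw [he]; exact (ENNReal.toReal_mono ENNReal.ofReal_ne_top hek_lt.le).trans_eq
          (ENNReal.toReal_ofReal hη0.le)
      have hsum_fin : Bk k + ek * Mk ≠ ⊤ :=
        ENNReal.add_ne_top.2 ⟨hBk_fin k hk', ENNReal.mul_ne_top hek_fin hMk_fin⟩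
      have hsum_real : (Bk k + ek * Mk).toReal = b + e * m := by
        rw [ENNReal.toReal_add (hBk_fin k hk') (ENNReal.mul_ne_top hek_fin hMk_fin),
          ENNReal.toReal_mul]
      have hm_le : m ≤ b + e * m := by
        rw [hm, ← hsum_real]; exact ENNReal.toReal_mono hsum_fin hMkle
      have hreal : b + e * m ≤ b * Real.exp ((1 + δ) * e) :=
        gronwall_step_real ENNReal.toReal_nonneg ENNReal.toReal_nonneg heη hδ hηδ hη1 hm_le
      -- back to `ℝ≥0∞`: `B_{k+1} ≤ B_k exp((1+δ) e)`
      have hBk1 : Bk (k + 1) ≤ Bk k * ENNReal.ofReal (Real.exp ((1 + δ) * e)) := by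
        calc Bk (k + 1) = Bk k + ∫⁻ σ in I, a σ * φ σ := by
              simp only [hBk]
              rw [lintegral_Ioc_add_Ioc (hτnn k) (hτmono k), add_assoc]
          _ ≤ Bk k + ek * Mk := by gcongr
          _ = ENNReal.ofReal (b + e * m) := by rw [← hsum_real, ENNReal.ofReal_toReal hsum_fin]
          _ ≤ ENNReal.ofReal (b * Real.exp ((1 + δ) * e)) := ENNReal.ofReal_le_ofReal hreal
          _ = Bk k * ENNReal.ofReal (Real.exp ((1 + δ) * e)) := by
              rw [ENNReal.ofReal_mul ENNReal.toReal_nonneg, ENNReal.ofReal_toReal (hBk_fin k hk')]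
      -- the exponents add up
      have hAk1 : (Ak (k + 1)).toReal = (Ak k).toReal + e := by
        simp only [hAk]
        rw [lintegral_Ioc_add_Ioc (hτnn k) (hτmono k), ENNReal.toReal_add (hAk_fin k hk') hek_fin]
      calc Bk (k + 1) ≤ Bk k * ENNReal.ofReal (Real.exp ((1 + δ) * e)) := hBk1
        _ ≤ B * ENNReal.ofReal (Real.exp ((1 + δ) * (Ak k).toReal)) *
              ENNReal.ofReal (Real.exp ((1 + δ) * e)) := by gcongr
        _ = B * ENNReal.ofReal (Real.exp ((1 + δ) * (Ak (k + 1)).toReal)) := by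
              rw [hAk1, mul_add, Real.exp_add, ENNReal.ofReal_mul (Real.exp_nonneg _), mul_assoc]
  -- conclusion at `k = N`
  have hfin := key N le_rfl
  have hBN : φ t ≤ Bk N := by
    have := hφ' t ht
    simp only [hBk, hτN]
    exact this
  have hAN : (Ak N).toReal = (∫⁻ s in Ioo 0 t, a s).toReal := by
    simp only [hAk, hτN, lintegral_Ioo_eq_lintegral_Ioc]
  rw [← hAN]
  exact hBN.trans hfin

end Gronwall

/-! ### Young's inequality with absorption; the Serrin constant -/

section Young

/-- **Young's inequality with absorption into the dissipation.** For `0 < θ < 1`, `ν > 0` and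
`a, x, y ≥ 0`: `a y^θ x^{1-θ} ≤ (ν/2) x + θ (2(1-θ))^{(1-θ)/θ} ν^{-(1-θ)/θ} a^{1/θ} y`
(weighted AM–GM `X^{1-θ} Y^θ ≤ (1-θ)X + θY` with `X = ν x/(2(1-θ))`; Lemarié-Rieusset 2016,
proof of Thm. 11.2, the passage to `C_σ ν^{-(1+σ)/(1-σ)} ‖u‖_q^{2/(1-σ)} ‖u‖²_{Ḣ¹}`). [folklore] -/
theorem mul_rpow_mul_rpow_le_absorb {θ : ℝ} (hθ0 : 0 < θ) (hθ1 : θ < 1) {ν : ℝ} (hν : 0 < ν)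
    {a x y : ℝ} (ha : 0 ≤ a) (hx : 0 ≤ x) (hy : 0 ≤ y) :
    a * y ^ θ * x ^ (1 - θ) ≤ ν / 2 * x +
      θ * (2 * (1 - θ)) ^ ((1 - θ) / θ) * ν ^ (-((1 - θ) / θ)) * a ^ (1 / θ) * y := by
  have h1θ : 0 < 1 - θ := sub_pos.2 hθ1
  -- `X = ν x / (2(1-θ))`, `Y = a^{1/θ} y (2(1-θ)/ν)^{(1-θ)/θ}`
  set c : ℝ := 2 * (1 - θ) / ν with hc
  have hc0 : 0 < c := div_pos (by linarith) hν
  set X : ℝ := x / c with hX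
  set Y : ℝ := a ^ (1 / θ) * y * c ^ ((1 - θ) / θ) with hY
  have hX0 : 0 ≤ X := div_nonneg hx hc0.le
  have hY0 : 0 ≤ Y := by positivity
  have hAMGM := Real.geom_mean_le_arith_mean2_weighted h1θ.le hθ0.le hX0 hY0 (by ring)
  -- identify the geometric mean with the left-hand side
  have hgeo : X ^ (1 - θ) * Y ^ θ = a * y ^ θ * x ^ (1 - θ) := by
    rw [hY, hX, Real.mul_rpow (by positivity) (by positivity), Real.mul_rpow (by positivity) hy,
      Real.div_rpow hx hc0.le, ← Real.rpow_mul ha, ← Real.rpow_mul hc0.le]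
    have h1 : 1 / θ * θ = 1 := by field_simp
    have h2 : (1 - θ) / θ * θ = 1 - θ := by field_simp
    rw [h1, h2, Real.rpow_one]
    have hcpow : c ^ (1 - θ) ≠ 0 := (Real.rpow_pos_of_pos hc0 _).ne'
    field_simp
  -- identify the arithmetic mean with the right-hand side
  have harith : (1 - θ) * X + θ * Y = ν / 2 * x +
      θ * (2 * (1 - θ)) ^ ((1 - θ) / θ) * ν ^ (-((1 - θ) / θ)) * a ^ (1 / θ) * y := by
    have hX' : (1 - θ) * X = ν / 2 * x := by
      rw [hX, hc]; field_simp
    have hcpow : c ^ ((1 - θ) / θ) = (2 * (1 - θ)) ^ ((1 - θ) / θ) * ν ^ (-((1 - θ) / θ)) := by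
      rw [hc, Real.div_rpow (by linarith) hν.le, Real.rpow_neg hν.le, div_eq_mul_inv]
    rw [hX', hY, hcpow]; ring
  rw [← hgeo, ← harith]
  exact hAMGM

/-- Bookkeeping of the Serrin constant: with `a = (2ν)⁻¹ N² K^{2(1-θ)}` the Young bound of
`mul_rpow_mul_rpow_le_absorb` reads `C(θ) ν^{1-2/θ} N^{2/θ}` with
`C(θ) = θ (2(1-θ))^{(1-θ)/θ} 2^{-1/θ} K^{2(1-θ)/θ}` (so that `ν` enters as `ν^{1-q}`, `q = 2/θ`,
Lemarié-Rieusset 2016, (11.11)). [folklore] -/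
theorem serrin_const_identity {θ ν N K : ℝ} (hθ0 : 0 < θ) (hν : 0 < ν) (hN : 0 ≤ N)
    (hK : 0 ≤ K) :
    θ * (2 * (1 - θ)) ^ ((1 - θ) / θ) * ν ^ (-((1 - θ) / θ)) *
        ((2 * ν)⁻¹ * N ^ 2 * K ^ (2 * (1 - θ))) ^ (1 / θ) =
      (θ * (2 * (1 - θ)) ^ ((1 - θ) / θ) * 2 ^ (-(1 / θ)) * K ^ (2 * (1 - θ) / θ)) *
        ν ^ (1 - 2 / θ) * N ^ (2 / θ) := by
  have h2ν : 0 < 2 * ν := by positivity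
  -- split the power of the product
  have hsplit : ((2 * ν)⁻¹ * N ^ 2 * K ^ (2 * (1 - θ))) ^ (1 / θ) =
      2 ^ (-(1 / θ)) * ν ^ (-(1 / θ)) * N ^ (2 / θ) * K ^ (2 * (1 - θ) / θ) := by
    have hKnn : 0 ≤ K ^ (2 * (1 - θ)) := Real.rpow_nonneg hK _
    rw [Real.mul_rpow (by positivity) hKnn, Real.mul_rpow (by positivity) (by positivity),
      Real.inv_rpow h2ν.le, Real.mul_rpow (by norm_num) hν.le, ← Real.rpow_natCast N 2,
      ← Real.rpow_mul hN, ← Real.rpow_mul hK, mul_inv, ← Real.rpow_neg (by norm_num),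
      ← Real.rpow_neg hν.le]
    have hKexp : 2 * (1 - θ) * (1 / θ) = 2 * (1 - θ) / θ := by field_simp
    have hNexp : ((2 : ℕ) : ℝ) * (1 / θ) = 2 / θ := by push_cast; field_simp
    rw [hKexp, hNexp]
  have hνpow : ν ^ (-((1 - θ) / θ)) * ν ^ (-(1 / θ)) = ν ^ (1 - 2 / θ) := by
    rw [← Real.rpow_add hν]
    congr 1
    field_simp
    ring
  rw [hsplit]
  calc θ * (2 * (1 - θ)) ^ ((1 - θ) / θ) * ν ^ (-((1 - θ) / θ)) *
        (2 ^ (-(1 / θ)) * ν ^ (-(1 / θ)) * N ^ (2 / θ) * K ^ (2 * (1 - θ) / θ))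
      = θ * (2 * (1 - θ)) ^ ((1 - θ) / θ) * 2 ^ (-(1 / θ)) * K ^ (2 * (1 - θ) / θ) *
          (ν ^ (-((1 - θ) / θ)) * ν ^ (-(1 / θ))) * N ^ (2 / θ) := by ring
    _ = _ := by rw [hνpow]

/-- **One component of the Serrin absorption** (`3 < r < ∞`): if
`P ≤ N² a^θ (K² R)^{1-θ}` (the key estimate `integral_sq_norm_mul_norm_fderiv_apply_le` for the
`j`-th slice), then `(2ν)⁻¹ P ≤ (ν/2) R + C(θ) ν^{1-2/θ} N^{2/θ} a` (Lemarié-Rieusset 2016, proof of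
Thm. 11.2; Robinson–Rodrigo–Sadowski 2016, proof of Lemma 8.16, the Young step
`… ≤ c ‖u‖_{L^s}^r ‖∇u‖² + ½‖Au‖²`). [cite: LemarieRieusset2016, Thm. 11.2 (proof)] -/
theorem serrin_absorb_component {θ ν N K P a R : ℝ} (hθ0 : 0 < θ) (hθ1 : θ < 1) (hν : 0 < ν)
    (hN : 0 ≤ N) (hK : 0 ≤ K) (ha : 0 ≤ a) (hR : 0 ≤ R)
    (hP : P ≤ N ^ 2 * a ^ θ * (K ^ 2 * R) ^ (1 - θ)) :
    (2 * ν)⁻¹ * P ≤ ν / 2 * R +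
      (θ * (2 * (1 - θ)) ^ ((1 - θ) / θ) * 2 ^ (-(1 / θ)) * K ^ (2 * (1 - θ) / θ)) *
        ν ^ (1 - 2 / θ) * N ^ (2 / θ) * a := by
  set A : ℝ := (2 * ν)⁻¹ * N ^ 2 * K ^ (2 * (1 - θ)) with hAdef
  have hA0 : 0 ≤ A := by positivity
  have h1 : (2 * ν)⁻¹ * P ≤ A * a ^ θ * R ^ (1 - θ) := by
    have hKR : (K ^ 2 * R) ^ (1 - θ) = K ^ (2 * (1 - θ)) * R ^ (1 - θ) := by
      rw [Real.mul_rpow (sq_nonneg _) hR, ← Real.rpow_natCast K 2, ← Real.rpow_mul hK]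
      norm_num
    calc (2 * ν)⁻¹ * P ≤ (2 * ν)⁻¹ * (N ^ 2 * a ^ θ * (K ^ 2 * R) ^ (1 - θ)) :=
          mul_le_mul_of_nonneg_left hP (by positivity)
      _ = A * a ^ θ * R ^ (1 - θ) := by rw [hKR, hAdef]; ring
  have h2 := mul_rpow_mul_rpow_le_absorb hθ0 hθ1 hν hA0 hR ha
  have h3 : θ * (2 * (1 - θ)) ^ ((1 - θ) / θ) * ν ^ (-((1 - θ) / θ)) * A ^ (1 / θ) =
      (θ * (2 * (1 - θ)) ^ ((1 - θ) / θ) * 2 ^ (-(1 / θ)) * K ^ (2 * (1 - θ) / θ)) *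
        ν ^ (1 - 2 / θ) * N ^ (2 / θ) := by
    rw [hAdef]
    exact serrin_const_identity hθ0 hν hN hK
  calc (2 * ν)⁻¹ * P ≤ A * a ^ θ * R ^ (1 - θ) := h1
    _ ≤ ν / 2 * R + θ * (2 * (1 - θ)) ^ ((1 - θ) / θ) * ν ^ (-((1 - θ) / θ)) * A ^ (1 / θ) * a := h2
    _ = _ := by rw [h3]

/-- **The endpoint `r = ∞`** of the absorption (`θ = 1`, `C(1) = 1/2`): if `Pⱼ ≤ N² aⱼ` then
`(2ν)⁻¹ Σⱼ Pⱼ ≤ (ν/2) Σⱼ Rⱼ + C(1) ν^{-1} N² Σⱼ aⱼ`, written with the constant `C(θ)` evaluated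
literally at `θ = 1` (Lemarié-Rieusset 2016, Thm. 11.2 at `(p, q) = (2, ∞)`). [folklore] -/
theorem serrin_absorb_sum_top {ν N K : ℝ} (hν : 0 < ν) {P a R : Fin 3 → ℝ}
    (hR : ∀ j, 0 ≤ R j) (hP : ∀ j, P j ≤ N ^ 2 * a j) :
    (2 * ν)⁻¹ * ∑ j, P j ≤ ν / 2 * ∑ j, R j +
      ((1 : ℝ) * (2 * (1 - 1)) ^ ((1 - 1) / (1 : ℝ)) * 2 ^ (-(1 / (1 : ℝ))) *
        K ^ (2 * (1 - 1) / (1 : ℝ))) * ν ^ (1 - 2 / (1 : ℝ)) * N ^ (2 / (1 : ℝ)) * ∑ j, a j := by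
  have hsumR : 0 ≤ ∑ j, R j := Finset.sum_nonneg fun j _ => hR j
  have h1 : (2 * ν)⁻¹ * ∑ j, P j ≤ (2 * ν)⁻¹ * (N ^ 2 * ∑ j, a j) := by
    rw [Finset.mul_sum Finset.univ a (N ^ 2)]
    exact mul_le_mul_of_nonneg_left (Finset.sum_le_sum fun j _ => hP j) (by positivity)
  have h2 : ((1 : ℝ) * (2 * (1 - 1)) ^ ((1 - 1) / (1 : ℝ)) * 2 ^ (-(1 / (1 : ℝ))) *
        K ^ (2 * (1 - 1) / (1 : ℝ))) * ν ^ (1 - 2 / (1 : ℝ)) * N ^ (2 / (1 : ℝ)) =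
      (2 * ν)⁻¹ * N ^ 2 := by
    have hν2 : ν ^ (1 - 2 / (1 : ℝ)) = ν⁻¹ := by norm_num [Real.rpow_neg_one]
    have hN2 : N ^ (2 / (1 : ℝ)) = N ^ 2 := by norm_num [Real.rpow_two]
    have h22 : (2 : ℝ) ^ (-(1 / (1 : ℝ))) = 2⁻¹ := by norm_num [Real.rpow_neg_one]
    have h01 : (2 * (1 - 1) : ℝ) ^ ((1 - 1) / (1 : ℝ)) = 1 := by norm_num
    have hK0 : K ^ (2 * (1 - 1) / (1 : ℝ)) = 1 := by norm_num
    rw [hν2, hN2, h22, h01, hK0]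
    ring
  rw [h2]
  nlinarith [mul_nonneg (div_nonneg hν.le zero_le_two) hsumR]

end Young

/-! ### Slices in `L^r`: continuous essentially bounded fields, `L² ∩ L^∞ ⊂ L^r` -/

section LrHelpers

/-- A continuous function with finite `L^∞` norm (for a measure positive on open sets) is bounded
**everywhere** by `‖f‖_{L^∞}`: the open set where the bound fails is null, hence empty. [folklore] -/
theorem norm_le_toReal_eLpNorm_top_of_continuous {X F : Type*} [TopologicalSpace X] [MeasurableSpace X]
    [OpensMeasurableSpace X] {μ : Measure X} [μ.IsOpenPosMeasure] [NormedAddCommGroup F]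
    {f : X → F} (hf : Continuous f) (hfin : eLpNorm f ⊤ μ < ⊤) (x : X) :
    ‖f x‖ ≤ (eLpNorm f ⊤ μ).toReal := by
  rw [eLpNorm_exponent_top] at hfin ⊢
  have hae : ∀ᵐ y ∂μ, ‖f y‖ₑ ≤ eLpNormEssSup f μ := ae_le_eLpNormEssSup
  have hae' : ∀ᵐ y ∂μ, ‖f y‖ ≤ (eLpNormEssSup f μ).toReal := hae.mono fun y hy => by
    rw [← toReal_enorm]
    exact ENNReal.toReal_mono hfin.ne hy
  -- the open set where the bound fails is null, hence empty
  by_contra hlt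
  push Not at hlt
  have hopen : IsOpen {y | (eLpNormEssSup f μ).toReal < ‖f y‖} :=
    isOpen_lt continuous_const hf.norm
  have hne : ({y | (eLpNormEssSup f μ).toReal < ‖f y‖} : Set X).Nonempty := ⟨x, hlt⟩
  have hpos := hopen.measure_pos μ hne
  have hzero : μ {y | (eLpNormEssSup f μ).toReal < ‖f y‖} = 0 := by
    rw [ae_iff] at hae'
    simpa only [not_le] using hae'
  exact hpos.ne' hzero

/-- `L² ∩ L^∞ ⊂ L^r` quantitatively, lower-integral form: for `2 ≤ r < ∞` and `‖f‖ ≤ B`,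
`∫ ‖f‖^r ≤ B^{r-2} ∫ ‖f‖²`. [folklore] -/
theorem lintegral_rpow_enorm_le_of_bound {X F : Type*} [MeasurableSpace X] {μ : Measure X}
    [NormedAddCommGroup F] {f : X → F} {B : ℝ} (hB0 : 0 ≤ B) (hB : ∀ x, ‖f x‖ ≤ B) {r : ℝ}
    (hr : 2 ≤ r) :
    ∫⁻ x, ‖f x‖ₑ ^ r ∂μ ≤ ENNReal.ofReal (B ^ (r - 2)) * ∫⁻ x, ‖f x‖ₑ ^ (2 : ℝ) ∂μ := by
  rw [← lintegral_const_mul' _ _ ENNReal.ofReal_ne_top]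
  refine lintegral_mono fun x => ?_
  have hsplit : ‖f x‖ₑ ^ r = ‖f x‖ₑ ^ (r - 2) * ‖f x‖ₑ ^ (2 : ℝ) := by
    rw [← ENNReal.rpow_add_of_nonneg _ _ (by linarith) (by norm_num)]; ring_nf
  rw [hsplit]
  gcongr
  calc ‖f x‖ₑ ^ (r - 2) ≤ (ENNReal.ofReal B) ^ (r - 2) := by
        gcongr
        rw [← ofReal_norm]
        exact ENNReal.ofReal_le_ofReal (hB x)
    _ = ENNReal.ofReal (B ^ (r - 2)) := ENNReal.ofReal_rpow_of_nonneg hB0 (by linarith)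

/-- A bounded field with `∫ ‖f‖² < ∞` lies in `L^r` for every `2 ≤ r ≤ ∞`. [folklore] -/
theorem eLpNorm_lt_top_of_bound_of_two {X F : Type*} [MeasurableSpace X] {μ : Measure X}
    [NormedAddCommGroup F] {f : X → F} {B : ℝ} (hB0 : 0 ≤ B) (hB : ∀ x, ‖f x‖ ≤ B)
    (h2 : ∫⁻ x, ‖f x‖ₑ ^ 2 ∂μ < ⊤) {r : ℝ≥0∞} (hr : 2 ≤ r) : eLpNorm f r μ < ⊤ := by
  rcases eq_or_ne r ⊤ with rfl | hrtop
  · rw [eLpNorm_exponent_top]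
    refine lt_of_le_of_lt (eLpNormEssSup_le_of_ae_enorm_bound (C := ENNReal.ofReal B)
      (Eventually.of_forall fun x => ?_)) ENNReal.ofReal_lt_top
    rw [← ofReal_norm]; exact ENNReal.ofReal_le_ofReal (hB x)
  have hr0 : r ≠ 0 := (lt_of_lt_of_le (by norm_num) hr).ne'
  have hr2 : 2 ≤ r.toReal := by
    rw [← ENNReal.toReal_ofNat 2]; exact ENNReal.toReal_mono hrtop hr
  rw [eLpNorm_eq_lintegral_rpow_enorm_toReal hr0 hrtop]
  refine ENNReal.rpow_lt_top_of_nonneg (by positivity) (lt_top_iff_ne_top.1 ?_)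
  refine lt_of_le_of_lt (lintegral_rpow_enorm_le_of_bound hB0 hB hr2) ?_
  refine ENNReal.mul_lt_top ENNReal.ofReal_lt_top ?_
  simpa [ENNReal.rpow_two] using h2

end LrHelpers

/-! ### The key estimate for one slice `vⱼ = ∂ⱼv` -/

section KeyEstimate

/-- Exponent algebra of the Serrin slice bound: for `ρ > 3` and `m = 2ρ/(ρ-2)`, `2 < m < 6`,
`(ρ/2, m/2)` are Hölder conjugate, and the interpolation exponents between `L²` and `L⁶` at `L^m`,
multiplied by `2/m`, are `1 - 3/ρ` and `1/ρ`. [folklore] -/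
theorem serrin_exponent_algebra {ρ : ℝ} (hρ : 3 < ρ) :
    let m : ℝ := 2 * ρ / (ρ - 2)
    2 < m ∧ m < 6 ∧ (ρ / 2).HolderConjugate (m / 2) ∧
      (6 - m) / (6 - 2) * (2 / m) = 1 - 3 / ρ ∧ (m - 2) / (6 - 2) * (2 / m) = 1 / ρ := by
  intro m
  have hρ2 : 0 < ρ - 2 := by linarith
  have hm : m = 2 * ρ / (ρ - 2) := rfl
  refine ⟨?_, ?_, ?_, ?_, ?_⟩
  · rw [hm, lt_div_iff₀ hρ2]; linarith
  · rw [hm, div_lt_iff₀ hρ2]; linarith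
  · rw [Real.holderConjugate_iff]
    refine ⟨by linarith, ?_⟩
    rw [hm]; field_simp; ring
  · rw [hm]; field_simp; ring
  · rw [hm]; field_simp; ring

/-- **The key estimate for one slice** (Robinson–Rodrigo–Sadowski 2016, proof of Lemma 8.16:
Hölder `‖u‖_{L^s} ‖∇u‖_{L^{2s/(s-2)}} ‖Au‖`, interpolation
`‖∇u‖_{L^{2s/(s-2)}} ≤ ‖∇u‖₂^{(s-3)/s} ‖∇u‖₆^{3/s}` and `‖∇u‖₆ ≤ c‖Au‖`; Lemarié-Rieusset 2016,
proof of Thm. 11.2). For a `C³` field `v` on `ℝ³` with `Dv, D²v ∈ L²`, bounded (for integrability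
only) and in `L^r`, `3 < r < ∞`, and the slice `vⱼ = ∂ⱼv`:
`∫ (|v| ‖vⱼ‖)² ≤ ‖v‖_r² (∫ ‖vⱼ‖²)^{1-3/r} (K² Σᵢ ∫ ‖∂ᵢvⱼ‖²)^{3/r}`,
`K` the Sobolev constant of `‖w‖_{L⁶} ≤ K‖Dw‖_{L²}`. Proof in `ℝ≥0∞`: Hölder with the conjugate
pair `(r/2, m/2)`, `m = 2r/(r-2)` (Mathlib `ENNReal.lintegral_mul_le_Lp_mul_Lq`), Lebesgue
interpolation of `∫ ‖vⱼ‖^m` between `2` and `6` (`lintegral_rpow_interpolate`), Sobolev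
`‖vⱼ‖₆ ≤ K‖Dvⱼ‖₂` (`eLpNorm_six_le_eLpNorm_fderiv_two`) and `‖Dvⱼ‖²_{L²} ≤ Σᵢ ∫‖∂ᵢvⱼ‖²`
(operator norm versus coordinate sum). [cite: RobinsonRodrigoSadowski2016, Lemma 8.16 (proof)] -/
theorem integral_sq_norm_mul_norm_fderiv_apply_le
    {v : EuclideanSpace ℝ (Fin 3) → EuclideanSpace ℝ (Fin 3)} (hv : ContDiff ℝ 3 v)
    (hv1 : ∫⁻ x, ‖iteratedFDeriv ℝ 1 v x‖ₑ ^ 2 < ⊤) (hv2 : ∫⁻ x, ‖iteratedFDeriv ℝ 2 v x‖ₑ ^ 2 < ⊤)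
    {B : ℝ} (hB : ∀ x, ‖v x‖ ≤ B) {r : ℝ≥0∞} (hr : 3 < r) (hrtop : r ≠ ⊤)
    (hvr : eLpNorm v r volume < ⊤) (j : Fin 3) :
    ∫ x, (‖v x‖ * ‖fderiv ℝ v x (EuclideanSpace.basisFun (Fin 3) ℝ j)‖) ^ 2 ≤
      (eLpNorm v r volume).toReal ^ 2 *
        (∫ x, ‖fderiv ℝ v x (EuclideanSpace.basisFun (Fin 3) ℝ j)‖ ^ 2) ^ (1 - 3 / r.toReal) *
        ((SNormLESNormFDerivOfEqConst (EuclideanSpace ℝ (Fin 3))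
            (volume : Measure (EuclideanSpace ℝ (Fin 3))) 2 : ℝ) ^ 2 *
          ∑ i, ∫ x, ‖fderiv ℝ (fun y => fderiv ℝ v y (EuclideanSpace.basisFun (Fin 3) ℝ j)) x
            (EuclideanSpace.basisFun (Fin 3) ℝ i)‖ ^ 2) ^ (3 / r.toReal) := by
  set e := EuclideanSpace.basisFun (Fin 3) ℝ with he
  set K : ℝ≥0 := SNormLESNormFDerivOfEqConst (EuclideanSpace ℝ (Fin 3))
    (volume : Measure (EuclideanSpace ℝ (Fin 3))) 2 with hK
  -- the real exponents
  have hr0 : r ≠ 0 := (lt_trans (by norm_num) hr).ne'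
  set ρ : ℝ := r.toReal with hρ
  have hρ3 : 3 < ρ := by
    rw [hρ, ← ENNReal.toReal_ofNat 3]; exact (ENNReal.toReal_lt_toReal (by norm_num) hrtop).2 hr
  have hρ0 : 0 < ρ := by linarith
  obtain ⟨h2m, hm6, hconj, hexpθ, hexp1⟩ := serrin_exponent_algebra hρ3
  set m : ℝ := 2 * ρ / (ρ - 2) with hm
  have hm0 : 0 < m := by linarith
  have hB0 : 0 ≤ B := (norm_nonneg _).trans (hB 0)
  -- the slice `vⱼ = ∂ⱼ v` and the second slices
  set vs : EuclideanSpace ℝ (Fin 3) → EuclideanSpace ℝ (Fin 3) := fun y => fderiv ℝ v y (e j) with hvs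
  have hvs2 : ContDiff ℝ 2 vs := (hv.fderiv_right (m := 2) (by norm_num)).clm_apply contDiff_const
  have hvs1 : ContDiff ℝ 1 vs := hvs2.of_le (by norm_num)
  have cv : Continuous v := hv.continuous
  have cvs : Continuous vs := hvs1.continuous
  have cdvs : ∀ i, Continuous fun x => fderiv ℝ vs x (e i) := fun i =>
    (hvs1.continuous_fderiv one_ne_zero).clm_apply continuous_const
  have n_vs : ∀ x, ‖vs x‖ ≤ ‖iteratedFDeriv ℝ 1 v x‖ := fun x => norm_fderiv_apply_basisFun_le v x j
  have n_dvs : ∀ i x, ‖fderiv ℝ vs x (e i)‖ ≤ ‖iteratedFDeriv ℝ 2 v x‖ := fun i x =>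
    (norm_fderiv_apply_basisFun_le vs x i).trans
      (norm_iteratedFDeriv_fderiv_apply_basisFun_le hv 1 (by norm_num) x j)
  have l2vs : ∫⁻ x, ‖vs x‖ₑ ^ 2 < ⊤ := lintegral_enorm_sq_lt_top_of_norm_le n_vs hv1
  have l2dvs : ∀ i, ∫⁻ x, ‖fderiv ℝ vs x (e i)‖ₑ ^ 2 < ⊤ := fun i =>
    lintegral_enorm_sq_lt_top_of_norm_le (n_dvs i) hv2
  -- the real quantities `a = ∫ ‖vⱼ‖²`, `R = Σᵢ ∫ ‖∂ᵢvⱼ‖²`, `P = ∫ (|v| ‖vⱼ‖)²`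
  have i_a : Integrable (fun x => ‖vs x‖ ^ 2) volume :=
    FluidPDE.integrable_sq_norm_of_lintegral_lt_top cvs l2vs
  have i_dd : ∀ i, Integrable (fun x => ‖fderiv ℝ vs x (e i)‖ ^ 2) volume := fun i =>
    FluidPDE.integrable_sq_norm_of_lintegral_lt_top (cdvs i) (l2dvs i)
  set a : ℝ := ∫ x, ‖vs x‖ ^ 2 with ha
  set R : ℝ := ∑ i, ∫ x, ‖fderiv ℝ vs x (e i)‖ ^ 2 with hR
  have ha0 : 0 ≤ a := integral_nonneg fun x => sq_nonneg _
  have hR0 : 0 ≤ R := Finset.sum_nonneg fun i _ => integral_nonneg fun x => sq_nonneg _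
  set g : EuclideanSpace ℝ (Fin 3) → ℝ := fun x => ‖v x‖ * ‖vs x‖ with hg
  have hg0 : ∀ x, 0 ≤ g x := fun x => mul_nonneg (norm_nonneg _) (norm_nonneg _)
  have hgm : AEStronglyMeasurable g volume := (cv.norm.mul cvs.norm).aestronglyMeasurable
  have i_g2 : Integrable (fun x => g x ^ 2) volume := by
    have hdom : Integrable (fun x => B ^ 2 * ‖vs x‖ ^ 2) volume := i_a.const_mul _
    refine hdom.mono' (hgm.pow 2) (Eventually.of_forall fun x => ?_)
    rw [Real.norm_of_nonneg (sq_nonneg _), hg]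
    dsimp only
    rw [mul_pow]
    exact mul_le_mul_of_nonneg_right (pow_le_pow_left₀ (norm_nonneg _) (hB x) 2) (sq_nonneg _)
  -- `ℝ≥0∞` versions: `A = ∫⁻ ‖vⱼ‖ₑ²`, `ofReal R ≥ ‖Dvⱼ‖₂²`, `ofReal P = ∫⁻ ‖v‖ₑ² ‖vⱼ‖ₑ²`
  have hA : ENNReal.ofReal a = ∫⁻ x, ‖vs x‖ₑ ^ (2 : ℝ) := by
    rw [ha, ofReal_integral_eq_lintegral_ofReal i_a (Eventually.of_forall fun x => sq_nonneg _)]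
    refine lintegral_congr fun x => ?_
    rw [← ofReal_norm, ENNReal.ofReal_rpow_of_nonneg (norm_nonneg _) (by norm_num), Real.rpow_two]
  have hD : eLpNorm (fderiv ℝ vs) 2 volume ^ 2 ≤ ENNReal.ofReal R := by
    rw [← lintegral_enorm_sq_eq_eLpNorm_two_sq, hR, ← integral_finsetSum _ fun i _ => i_dd i,
      ofReal_integral_eq_lintegral_ofReal (integrable_finsetSum _ fun i _ => i_dd i)
        (Eventually.of_forall fun x => Finset.sum_nonneg fun i _ => sq_nonneg _)]
    refine lintegral_mono fun x => ?_
    rw [← ofReal_norm, ← ENNReal.ofReal_pow (norm_nonneg _)]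
    exact ENNReal.ofReal_le_ofReal (FluidPDE.sq_opNorm_le_sum_sq_norm_apply e (fderiv ℝ vs x))
  have hP : ENNReal.ofReal (∫ x, g x ^ 2) = ∫⁻ x, ‖v x‖ₑ ^ (2 : ℝ) * ‖vs x‖ₑ ^ (2 : ℝ) := by
    rw [ofReal_integral_eq_lintegral_ofReal i_g2 (Eventually.of_forall fun x => sq_nonneg _)]
    refine lintegral_congr fun x => ?_
    rw [hg]
    dsimp only
    rw [mul_pow, ENNReal.ofReal_mul (sq_nonneg _), ← Real.rpow_two, ← Real.rpow_two,
      ← ENNReal.ofReal_rpow_of_nonneg (norm_nonneg _) (by norm_num),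
      ← ENNReal.ofReal_rpow_of_nonneg (norm_nonneg _) (by norm_num), ofReal_norm, ofReal_norm]
  -- Sobolev: `∫⁻ ‖vⱼ‖ₑ⁶ ≤ (K² R)³`
  have hS : eLpNorm vs 6 volume ≤ K * eLpNorm (fderiv ℝ vs) 2 volume :=
    FluidPDE.eLpNorm_six_le_eLpNorm_fderiv_two volume finrank_euclideanSpace_fin hvs1
      (eLpNorm_two_lt_top_of_lintegral_enorm_sq_lt_top l2vs)
  have hS6 : ∫⁻ x, ‖vs x‖ₑ ^ (6 : ℝ) ≤ ((K : ℝ≥0∞) ^ 2 * ENNReal.ofReal R) ^ (3 : ℝ) := by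
    have h6 : ∫⁻ x, ‖vs x‖ₑ ^ (6 : ℝ) = eLpNorm vs 6 volume ^ (6 : ℝ) := by
      rw [eLpNorm_eq_lintegral_rpow_enorm_toReal (by norm_num) (by norm_num), ENNReal.toReal_ofNat,
        ← ENNReal.rpow_mul]
      norm_num
    rw [h6]
    calc eLpNorm vs 6 volume ^ (6 : ℝ) ≤ (K * eLpNorm (fderiv ℝ vs) 2 volume) ^ (6 : ℝ) := by gcongr
      _ = ((K : ℝ≥0∞) ^ 2 * eLpNorm (fderiv ℝ vs) 2 volume ^ 2) ^ (3 : ℝ) := by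
          rw [← mul_pow, ← ENNReal.rpow_natCast, ← ENNReal.rpow_mul]; norm_num
      _ ≤ ((K : ℝ≥0∞) ^ 2 * ENNReal.ofReal R) ^ (3 : ℝ) := by gcongr
  -- Hölder `(ρ/2, m/2)` and interpolation
  have hHolder : ∫⁻ x, ‖v x‖ₑ ^ (2 : ℝ) * ‖vs x‖ₑ ^ (2 : ℝ) ≤
      (∫⁻ x, ‖v x‖ₑ ^ ρ) ^ (2 / ρ) * (∫⁻ x, ‖vs x‖ₑ ^ m) ^ (2 / m) := by
    have h := ENNReal.lintegral_mul_le_Lp_mul_Lq volume hconj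
      (f := fun x => ‖v x‖ₑ ^ (2 : ℝ)) (g := fun x => ‖vs x‖ₑ ^ (2 : ℝ))
      (cv.aemeasurable.enorm.pow_const _) (cvs.aemeasurable.enorm.pow_const _)
    have hf : ∀ x, (‖v x‖ₑ ^ (2 : ℝ)) ^ (ρ / 2) = ‖v x‖ₑ ^ ρ := fun x => by
      rw [← ENNReal.rpow_mul]; congr 1; field_simp
    have hgm' : ∀ x, (‖vs x‖ₑ ^ (2 : ℝ)) ^ (m / 2) = ‖vs x‖ₑ ^ m := fun x => by
      rw [← ENNReal.rpow_mul]; congr 1; field_simp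
    simp only [Pi.mul_apply, hf, hgm'] at h
    have e1 : 1 / (ρ / 2) = 2 / ρ := by field_simp
    have e2 : 1 / (m / 2) = 2 / m := by field_simp
    rwa [e1, e2] at h
  have hInterp : ∫⁻ x, ‖vs x‖ₑ ^ m ≤
      (∫⁻ x, ‖vs x‖ₑ ^ (2 : ℝ)) ^ ((6 - m) / (6 - 2)) * (∫⁻ x, ‖vs x‖ₑ ^ (6 : ℝ)) ^ ((m - 2) / (6 - 2)) :=
    lintegral_rpow_interpolate cvs.aemeasurable.enorm zero_lt_two (by norm_num) h2m.le hm6.le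
  -- assemble in `ℝ≥0∞`
  have hN : (∫⁻ x, ‖v x‖ₑ ^ ρ) ^ (2 / ρ) = eLpNorm v r volume ^ 2 := by
    rw [eLpNorm_eq_lintegral_rpow_enorm_toReal hr0 hrtop, ← hρ, ← ENNReal.rpow_natCast,
      ← ENNReal.rpow_mul]
    congr 1; push_cast; field_simp
  have hcomb : ENNReal.ofReal (∫ x, g x ^ 2) ≤
      eLpNorm v r volume ^ 2 * (ENNReal.ofReal a ^ (1 - 3 / ρ) *
        ((K : ℝ≥0∞) ^ 2 * ENNReal.ofReal R) ^ (3 / ρ)) := by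
    rw [hP]
    refine hHolder.trans ?_
    rw [hN]
    gcongr
    calc (∫⁻ x, ‖vs x‖ₑ ^ m) ^ (2 / m)
        ≤ ((∫⁻ x, ‖vs x‖ₑ ^ (2 : ℝ)) ^ ((6 - m) / (6 - 2)) *
            (∫⁻ x, ‖vs x‖ₑ ^ (6 : ℝ)) ^ ((m - 2) / (6 - 2))) ^ (2 / m) := by gcongr
      _ = (∫⁻ x, ‖vs x‖ₑ ^ (2 : ℝ)) ^ (1 - 3 / ρ) * ((∫⁻ x, ‖vs x‖ₑ ^ (6 : ℝ)) ^ (1 / ρ)) := by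
          rw [ENNReal.mul_rpow_of_nonneg _ _ (by positivity), ← ENNReal.rpow_mul,
            ← ENNReal.rpow_mul, hexpθ, hexp1]
      _ ≤ (∫⁻ x, ‖vs x‖ₑ ^ (2 : ℝ)) ^ (1 - 3 / ρ) *
            ((((K : ℝ≥0∞) ^ 2 * ENNReal.ofReal R) ^ (3 : ℝ)) ^ (1 / ρ)) := by gcongr
      _ = ENNReal.ofReal a ^ (1 - 3 / ρ) * ((K : ℝ≥0∞) ^ 2 * ENNReal.ofReal R) ^ (3 / ρ) := by
          rw [hA, ← ENNReal.rpow_mul]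
          congr 2; field_simp
  -- back to reals
  have hfinR : eLpNorm v r volume ^ 2 * (ENNReal.ofReal a ^ (1 - 3 / ρ) *
      ((K : ℝ≥0∞) ^ 2 * ENNReal.ofReal R) ^ (3 / ρ)) ≠ ⊤ := by
    refine ENNReal.mul_ne_top (ENNReal.pow_ne_top hvr.ne) (ENNReal.mul_ne_top ?_ ?_)
    · exact ENNReal.rpow_ne_top_of_nonneg (by rw [sub_nonneg, div_le_one hρ0]; linarith)
        ENNReal.ofReal_ne_top
    · exact ENNReal.rpow_ne_top_of_nonneg (by positivity)
        (ENNReal.mul_ne_top (ENNReal.pow_ne_top ENNReal.coe_ne_top) ENNReal.ofReal_ne_top)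
  have := (ENNReal.ofReal_le_iff_le_toReal hfinR).1 hcomb
  refine this.trans_eq ?_
  rw [ENNReal.toReal_mul, ENNReal.toReal_mul, ENNReal.toReal_pow, ← ENNReal.toReal_rpow,
    ← ENNReal.toReal_rpow, ENNReal.toReal_mul, ENNReal.toReal_pow, ENNReal.toReal_ofReal ha0,
    ENNReal.toReal_ofReal hR0, ENNReal.coe_toReal, mul_assoc]

end KeyEstimate

/-! ### The enstrophy production at a fixed time, in a Serrin class -/

section Slice

/-- **The enstrophy production bound in a Serrin class** (Lemarié-Rieusset 2016, (11.9) and the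
proof of Thm. 11.2; Robinson–Rodrigo–Sadowski 2016, proof of Lemma 8.16). Let `v : ℝ³ → ℝ³` be
`C³` and divergence free, `W : ℝ³ → ℝ³` and `q : ℝ³ → ℝ` be `C¹`, with the momentum equation
`W + (v·∇)v = νΔv - ∇q` (`ν > 0`; so `W = ∂ₜu`, `v = u(t)`, `q = p(t)` for a classical solution),
`v` bounded (for integrability only), `Dv, D²v, D³v, W, DW, q, Dq ∈ L²`, and `v ∈ L^r`, `3 < r ≤ ∞`.
With `θ = 1 - 3/r` (`= 1 - (3/r).toReal`, so `θ = 1` for `r = ∞`) and `q = 2/θ`: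
`∫ Σᵢ ⟪∂ᵢv, ∂ᵢW⟫ ≤ C(θ) ν^{1-q} ‖v‖_{L^r}^q ∫ |∇v|²`,
`C(θ) = θ (2(1-θ))^{(1-θ)/θ} 2^{-1/θ} K^{2(1-θ)/θ}`.
Proof: `∫ Σᵢ⟪∂ᵢv, ∂ᵢW⟫ = -∫⟪Δv, W⟫ = -ν‖Δv‖²₂ + ∫⟪Δv, (v·∇)v⟫` (the pressure term vanishes,
`div Δv = 0`), `⟪Δv, (v·∇)v⟫ ≤ (ν/2)|Δv|² + (2ν)⁻¹|v|²‖Dv‖²`, `‖Dv‖² ≤ Σⱼ|∂ⱼv|²`, then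
`integral_sq_norm_mul_norm_fderiv_apply_le` and `serrin_absorb_component` for each `j` and the
Hessian–Laplacian identity `Σⱼ Σᵢ ‖∂ᵢ∂ⱼv‖²₂ = ‖Δv‖²₂` — the dissipation cancels; at `r = ∞`
one uses `|v| ≤ ‖v‖_∞` pointwise instead (`serrin_absorb_sum_top`). [cite: LemarieRieusset2016, Thm. 11.2 with (11.9)] -/
theorem integral_sum_inner_fderiv_le_of_momentum_of_eLpNorm {ν : ℝ} (hν : 0 < ν)
    {v W : EuclideanSpace ℝ (Fin 3) → EuclideanSpace ℝ (Fin 3)} {q : EuclideanSpace ℝ (Fin 3) → ℝ}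
    (hv : ContDiff ℝ 3 v) (hW : ContDiff ℝ 1 W) (hq : ContDiff ℝ 1 q)
    (hmom : ∀ x, W x + FluidPDE.convect v v x = ν • (Δ v) x - gradient q x)
    (hdiv : VectorCalculus.IsDivFree v) {B : ℝ} (hB : ∀ x, ‖v x‖ ≤ B)
    {r : ℝ≥0∞} (hr : 3 < r) (hvr : eLpNorm v r volume < ⊤)
    {θ : ℝ} (hθ : θ = 1 - (3 / r).toReal)
    (hv1 : ∫⁻ x, ‖iteratedFDeriv ℝ 1 v x‖ₑ ^ 2 < ⊤) (hv2 : ∫⁻ x, ‖iteratedFDeriv ℝ 2 v x‖ₑ ^ 2 < ⊤)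
    (hv3 : ∫⁻ x, ‖iteratedFDeriv ℝ 3 v x‖ₑ ^ 2 < ⊤)
    (hW0 : ∫⁻ x, ‖W x‖ₑ ^ 2 < ⊤) (hW1 : ∫⁻ x, ‖iteratedFDeriv ℝ 1 W x‖ₑ ^ 2 < ⊤)
    (hq0 : ∫⁻ x, ‖q x‖ₑ ^ 2 < ⊤) (hq1 : ∫⁻ x, ‖iteratedFDeriv ℝ 1 q x‖ₑ ^ 2 < ⊤) :
    ∫ x, ∑ i, ⟪fderiv ℝ v x (EuclideanSpace.basisFun (Fin 3) ℝ i),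
        fderiv ℝ W x (EuclideanSpace.basisFun (Fin 3) ℝ i)⟫ ≤
      (θ * (2 * (1 - θ)) ^ ((1 - θ) / θ) * 2 ^ (-(1 / θ)) *
          (SNormLESNormFDerivOfEqConst (EuclideanSpace ℝ (Fin 3))
            (volume : Measure (EuclideanSpace ℝ (Fin 3))) 2 : ℝ) ^ (2 * (1 - θ) / θ)) *
        ν ^ (1 - 2 / θ) * (eLpNorm v r volume).toReal ^ (2 / θ) *
        ∫ x, FluidPDE.frobeniusNormSq (fderiv ℝ v x) := by
  set e := EuclideanSpace.basisFun (Fin 3) ℝ with he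
  have he1 : ∀ i, ‖e i‖ = 1 := fun i => by simp [he]
  set K : ℝ≥0 := SNormLESNormFDerivOfEqConst (EuclideanSpace ℝ (Fin 3))
    (volume : Measure (EuclideanSpace ℝ (Fin 3))) 2 with hK
  set N : ℝ := (eLpNorm v r volume).toReal with hNdef
  have hN0 : 0 ≤ N := ENNReal.toReal_nonneg
  have hB0 : 0 ≤ B := (norm_nonneg _).trans (hB 0)
  have hν' : 0 < ν⁻¹ := inv_pos.2 hν
  -- the exponent `θ ∈ (0, 1]`
  have hr0 : r ≠ 0 := (lt_trans (by norm_num) hr).ne'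
  have h3r : (3 / r).toReal < 1 := by
    rcases eq_or_ne r ⊤ with hrtop | hrtop
    · rw [hrtop, ENNReal.div_top, ENNReal.toReal_zero]; exact zero_lt_one
    · have hρ3 : 3 < r.toReal := by
        rw [← ENNReal.toReal_ofNat 3]; exact (ENNReal.toReal_lt_toReal (by norm_num) hrtop).2 hr
      rw [ENNReal.toReal_div, ENNReal.toReal_ofNat, div_lt_one (by linarith)]
      exact hρ3
  have hθ0 : 0 < θ := by rw [hθ]; linarith
  have hθ1 : θ ≤ 1 := by rw [hθ]; linarith [ENNReal.toReal_nonneg (a := 3 / r)]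
  -- smoothness and continuity
  have hv2' : ContDiff ℝ 2 v := hv.of_le (by norm_num)
  have hΔ1 : ContDiff ℝ 1 (Δ v) := contDiff_one_laplacian_of_contDiff_three hv
  have cv : Continuous v := hv.continuous
  have cDv : Continuous (fderiv ℝ v) := hv.continuous_fderiv (by norm_num)
  have cD2 : Continuous fun x => iteratedFDeriv ℝ 2 v x := hv.continuous_iteratedFDeriv (by norm_num)
  have cD3 : Continuous fun x => iteratedFDeriv ℝ 3 v x := hv.continuous_iteratedFDeriv (by norm_num)
  have cdiv : ∀ i, Continuous fun x => fderiv ℝ v x (e i) := fun i => cDv.clm_apply continuous_const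
  have cddv : ∀ i, Continuous fun x => fderiv ℝ (fun y => fderiv ℝ v y (e i)) x (e i) := fun i =>
    ((((hv.fderiv_right (m := 2) (by norm_num)).clm_apply contDiff_const).continuous_fderiv
      (by norm_num)).clm_apply continuous_const)
  have cdvs : ∀ j i, Continuous fun x => fderiv ℝ (fun y => fderiv ℝ v y (e j)) x (e i) := fun j i =>
    ((((hv.fderiv_right (m := 2) (by norm_num)).clm_apply contDiff_const).continuous_fderiv
      (by norm_num)).clm_apply continuous_const)
  have cW : Continuous W := hW.continuous
  have cDW : Continuous (fderiv ℝ W) := hW.continuous_fderiv one_ne_zero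
  have cdiW : ∀ i, Continuous fun x => fderiv ℝ W x (e i) := fun i => cDW.clm_apply continuous_const
  have cq : Continuous q := hq.continuous
  have cDq : Continuous (fderiv ℝ q) := hq.continuous_fderiv one_ne_zero
  have cdiq : ∀ i, Continuous fun x => fderiv ℝ q x (e i) := fun i => cDq.clm_apply continuous_const
  have cgq : Continuous (gradient q) := by
    have : gradient q = fun x => (InnerProductSpace.toDual ℝ _).symm (fderiv ℝ q x) := rfl
    rw [this]
    exact (InnerProductSpace.toDual ℝ (EuclideanSpace ℝ (Fin 3))).symm.continuous.comp cDq
  have cΔ : Continuous (Δ v) := hΔ1.continuous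
  have cdΔ : ∀ i, Continuous fun x => fderiv ℝ (Δ v) x (e i) := fun i =>
    (hΔ1.continuous_fderiv one_ne_zero).clm_apply continuous_const
  have cconv : Continuous (FluidPDE.convect v v) := cDv.clm_apply cv
  have c3D2 : Continuous fun x => (3 : ℝ) • iteratedFDeriv ℝ 2 v x := cD2.const_smul (3 : ℝ)
  have c3D3 : Continuous fun x => (3 : ℝ) • iteratedFDeriv ℝ 3 v x := cD3.const_smul (3 : ℝ)
  have cBDv : Continuous fun x => B • fderiv ℝ v x := cDv.const_smul B
  -- pointwise norm bounds
  have hDv_eq : ∀ x, ‖fderiv ℝ v x‖ = ‖iteratedFDeriv ℝ 1 v x‖ := fun x => by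
    rw [← norm_iteratedFDeriv_fderiv, norm_iteratedFDeriv_zero]
  have n_Δ : ∀ x, ‖(Δ v) x‖ ≤ ‖(3 : ℝ) • iteratedFDeriv ℝ 2 v x‖ := fun x => by
    rw [norm_smul, Real.norm_of_nonneg (by norm_num : (0 : ℝ) ≤ 3)]
    exact norm_laplacian_le_three_mul_norm_iteratedFDeriv_two hv2' x
  have n_dΔ : ∀ i x, ‖fderiv ℝ (Δ v) x (e i)‖ ≤ ‖(3 : ℝ) • iteratedFDeriv ℝ 3 v x‖ := fun i x => by
    rw [norm_smul, Real.norm_of_nonneg (by norm_num : (0 : ℝ) ≤ 3),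
      fderiv_laplacian_apply_of_contDiff_three hv x (e i)]
    exact (norm_laplacian_le_three_mul_norm_iteratedFDeriv_two
      ((hv.fderiv_right (m := 2) (by norm_num)).clm_apply contDiff_const) x).trans
      (mul_le_mul_of_nonneg_left (norm_iteratedFDeriv_fderiv_apply_basisFun_le hv 2 (by norm_num) x i)
        (by norm_num))
  have n_conv : ∀ x, ‖FluidPDE.convect v v x‖ ≤ ‖B • fderiv ℝ v x‖ := fun x => by
    rw [FluidPDE.convect, norm_smul, Real.norm_of_nonneg hB0, mul_comm]
    exact (fderiv ℝ v x).le_opNorm_of_le (hB x)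
  have n_gq : ∀ x, ‖gradient q x‖ = ‖iteratedFDeriv ℝ 1 q x‖ := fun x => by
    rw [gradient, LinearIsometryEquiv.norm_map, ← norm_iteratedFDeriv_fderiv, norm_iteratedFDeriv_zero]
  have hin : ∀ i (y : EuclideanSpace ℝ (Fin 3)), ‖⟪e i, y⟫‖ ≤ ‖y‖ := fun i y =>
    (norm_inner_le_norm (𝕜 := ℝ) (e i) y).trans (by rw [he1, one_mul])
  -- finite `L²` norms
  have l2Dv : ∫⁻ x, ‖fderiv ℝ v x‖ₑ ^ 2 < ⊤ :=
    lintegral_enorm_sq_lt_top_of_norm_le (fun x => (hDv_eq x).le) hv1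
  have l2Δ : ∫⁻ x, ‖(3 : ℝ) • iteratedFDeriv ℝ 2 v x‖ₑ ^ 2 < ⊤ := by
    have : ∀ x, ‖(3 : ℝ) • iteratedFDeriv ℝ 2 v x‖ₑ ^ 2 =
        ENNReal.ofReal (3 ^ 2) * ‖iteratedFDeriv ℝ 2 v x‖ₑ ^ 2 := by
      intro x
      rw [enorm_smul, mul_pow, Real.enorm_eq_ofReal (by norm_num : (0:ℝ) ≤ 3),
        ENNReal.ofReal_pow (by norm_num : (0:ℝ) ≤ 3)]
    simp_rw [this]
    rw [lintegral_const_mul' _ _ ENNReal.ofReal_ne_top]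
    exact ENNReal.mul_lt_top ENNReal.ofReal_lt_top hv2
  have l2dΔ : ∫⁻ x, ‖(3 : ℝ) • iteratedFDeriv ℝ 3 v x‖ₑ ^ 2 < ⊤ := by
    have : ∀ x, ‖(3 : ℝ) • iteratedFDeriv ℝ 3 v x‖ₑ ^ 2 =
        ENNReal.ofReal (3 ^ 2) * ‖iteratedFDeriv ℝ 3 v x‖ₑ ^ 2 := by
      intro x
      rw [enorm_smul, mul_pow, Real.enorm_eq_ofReal (by norm_num : (0:ℝ) ≤ 3),
        ENNReal.ofReal_pow (by norm_num : (0:ℝ) ≤ 3)]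
    simp_rw [this]
    rw [lintegral_const_mul' _ _ ENNReal.ofReal_ne_top]
    exact ENNReal.mul_lt_top ENNReal.ofReal_lt_top hv3
  have l2gq : ∫⁻ x, ‖gradient q x‖ₑ ^ 2 < ⊤ :=
    lintegral_enorm_sq_lt_top_of_norm_le (fun x => (n_gq x).le) hq1
  have l2diq : ∀ i, ∫⁻ x, ‖fderiv ℝ q x (e i)‖ₑ ^ 2 < ⊤ := fun i =>
    lintegral_enorm_sq_lt_top_of_norm_le (fun x => norm_fderiv_apply_basisFun_le q x i) hq1
  have l2ddv : ∀ i, ∫⁻ x, ‖fderiv ℝ (fun y => fderiv ℝ v y (e i)) x (e i)‖ₑ ^ 2 < ⊤ := fun i =>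
    lintegral_enorm_sq_lt_top_of_norm_le (fun x => norm_fderiv_fderiv_apply_basisFun_le hv2' x i) hv2
  have l2div : ∀ i, ∫⁻ x, ‖fderiv ℝ v x (e i)‖ₑ ^ 2 < ⊤ := fun i =>
    lintegral_enorm_sq_lt_top_of_norm_le (fun x => by
      simpa [he1] using (fderiv ℝ v x).le_opNorm (e i)) l2Dv
  have l2diW : ∀ i, ∫⁻ x, ‖fderiv ℝ W x (e i)‖ₑ ^ 2 < ⊤ := fun i =>
    lintegral_enorm_sq_lt_top_of_norm_le (fun x => norm_fderiv_apply_basisFun_le W x i) hW1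
  have l2dvs : ∀ j i, ∫⁻ x, ‖fderiv ℝ (fun y => fderiv ℝ v y (e j)) x (e i)‖ₑ ^ 2 < ⊤ := fun j i =>
    lintegral_enorm_sq_lt_top_of_norm_le (fun x =>
      (norm_fderiv_apply_basisFun_le (fun y => fderiv ℝ v y (e j)) x i).trans
        (norm_iteratedFDeriv_fderiv_apply_basisFun_le hv 1 (by norm_num) x j)) hv2
  -- integrability of the products
  have i1 : ∀ i, Integrable (fun x => ⟪fderiv ℝ (fun y => fderiv ℝ v y (e i)) x (e i), W x⟫)
      volume := fun i =>
    integrable_of_norm_le_mul_of_lintegral_sq ((cddv i).inner cW).aestronglyMeasurable (cddv i) cW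
      (l2ddv i) hW0 fun x => norm_inner_le_norm _ _
  have i2 : ∀ i, Integrable (fun x => ⟪fderiv ℝ v x (e i), fderiv ℝ W x (e i)⟫) volume := fun i =>
    integrable_of_norm_le_mul_of_lintegral_sq ((cdiv i).inner (cdiW i)).aestronglyMeasurable
      (cdiv i) (cdiW i) (l2div i) (l2diW i) fun x => norm_inner_le_norm _ _
  have i3 : ∀ i, Integrable (fun x => ⟪fderiv ℝ v x (e i), W x⟫) volume := fun i =>
    integrable_of_norm_le_mul_of_lintegral_sq ((cdiv i).inner cW).aestronglyMeasurable (cdiv i) cW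
      (l2div i) hW0 fun x => norm_inner_le_norm _ _
  have iΔΔ : Integrable (fun x => ‖(Δ v) x‖ ^ 2) volume :=
    FluidPDE.integrable_sq_norm_of_lintegral_lt_top cΔ (lintegral_enorm_sq_lt_top_of_norm_le n_Δ l2Δ)
  have iΔg : Integrable (fun x => ⟪(Δ v) x, gradient q x⟫) volume :=
    integrable_of_norm_le_mul_of_lintegral_sq (cΔ.inner cgq).aestronglyMeasurable c3D2 cgq
      l2Δ l2gq fun x => (norm_inner_le_norm _ _).trans
        (mul_le_mul_of_nonneg_right (n_Δ x) (norm_nonneg _))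
  have iDv : Integrable (fun x => ‖fderiv ℝ v x‖ ^ 2) volume :=
    FluidPDE.integrable_sq_norm_of_lintegral_lt_top cDv l2Dv
  have lfrob : ∫⁻ x, ENNReal.ofReal (FluidPDE.frobeniusNormSq (fderiv ℝ v x)) < ⊤ :=
    calc ∫⁻ x, ENNReal.ofReal (FluidPDE.frobeniusNormSq (fderiv ℝ v x))
        ≤ ∫⁻ x, 3 * ‖fderiv ℝ v x‖ₑ ^ 2 :=
          lintegral_mono fun x => ofReal_frobeniusNormSq_le_three_mul_enorm_sq _
      _ = 3 * ∫⁻ x, ‖fderiv ℝ v x‖ₑ ^ 2 := lintegral_const_mul' _ _ (by norm_num)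
      _ < ⊤ := ENNReal.mul_lt_top (by norm_num) l2Dv
  have ifrob : Integrable (fun x => FluidPDE.frobeniusNormSq (fderiv ℝ v x)) volume :=
    integrable_of_continuous_of_nonneg (FluidPDE.continuous_frobeniusNormSq_fderiv hv (by simp))
      (fun x => FluidPDE.frobeniusNormSq_nonneg _) lfrob
  have iP : Integrable (fun x => (‖v x‖ * ‖fderiv ℝ v x‖) ^ 2) volume := by
    have hdom : Integrable (fun x => B ^ 2 * ‖fderiv ℝ v x‖ ^ 2) volume := iDv.const_mul _
    refine hdom.mono' ((cv.norm.mul cDv.norm).aestronglyMeasurable.pow 2)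
      (Eventually.of_forall fun x => ?_)
    rw [Real.norm_of_nonneg (sq_nonneg _), mul_pow]
    exact mul_le_mul_of_nonneg_right (pow_le_pow_left₀ (norm_nonneg _) (hB x) 2) (sq_nonneg _)
  -- the per-component real quantities
  have i_a : ∀ j, Integrable (fun x => ‖fderiv ℝ v x (e j)‖ ^ 2) volume := fun j =>
    FluidPDE.integrable_sq_norm_of_lintegral_lt_top (cdiv j) (l2div j)
  have i_dd : ∀ j i, Integrable (fun x => ‖fderiv ℝ (fun y => fderiv ℝ v y (e j)) x (e i)‖ ^ 2)
      volume := fun j i => FluidPDE.integrable_sq_norm_of_lintegral_lt_top (cdvs j i) (l2dvs j i)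
  have i_Pj : ∀ j, Integrable (fun x => (‖v x‖ * ‖fderiv ℝ v x (e j)‖) ^ 2) volume := by
    intro j
    have hdom : Integrable (fun x => B ^ 2 * ‖fderiv ℝ v x (e j)‖ ^ 2) volume := (i_a j).const_mul _
    refine hdom.mono' ((cv.norm.mul (cdiv j).norm).aestronglyMeasurable.pow 2)
      (Eventually.of_forall fun x => ?_)
    rw [Real.norm_of_nonneg (sq_nonneg _), mul_pow]
    exact mul_le_mul_of_nonneg_right (pow_le_pow_left₀ (norm_nonneg _) (hB x) 2) (sq_nonneg _)
  set a : Fin 3 → ℝ := fun j => ∫ x, ‖fderiv ℝ v x (e j)‖ ^ 2 with ha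
  set R : Fin 3 → ℝ := fun j => ∑ i, ∫ x, ‖fderiv ℝ (fun y => fderiv ℝ v y (e j)) x (e i)‖ ^ 2
    with hR
  set P : Fin 3 → ℝ := fun j => ∫ x, (‖v x‖ * ‖fderiv ℝ v x (e j)‖) ^ 2 with hP
  have ha0 : ∀ j, 0 ≤ a j := fun j => integral_nonneg fun x => sq_nonneg _
  have hR0 : ∀ j, 0 ≤ R j := fun j => Finset.sum_nonneg fun i _ => integral_nonneg fun x => sq_nonneg _
  have hP0 : ∀ j, 0 ≤ P j := fun j => integral_nonneg fun x => sq_nonneg _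
  -- `Σⱼ aⱼ = ∫ |∇v|²_F`, `Σⱼ Rⱼ = ∫ ‖Δv‖²`, `∫ (|v| ‖Dv‖)² ≤ Σⱼ Pⱼ`
  have hsum_a : ∑ j, a j = ∫ x, FluidPDE.frobeniusNormSq (fderiv ℝ v x) := by
    rw [ha, ← integral_finsetSum _ fun j _ => i_a j]
    refine integral_congr_ae (Eventually.of_forall fun x => ?_)
    simp only
    rw [FluidPDE.frobeniusNormSq_eq_sum e]
  have hHess : ∑ j, R j = ∫ x, ‖(Δ v) x‖ ^ 2 :=
    sum_sum_integral_sq_norm_fderiv_fderiv_eq_integral_sq_norm_laplacian hv hv1 hv2 hv3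
  have hPsum : ∫ x, (‖v x‖ * ‖fderiv ℝ v x‖) ^ 2 ≤ ∑ j, P j := by
    rw [hP, ← integral_finsetSum _ fun j _ => i_Pj j]
    refine integral_mono iP (integrable_finsetSum _ fun j _ => i_Pj j) fun x => ?_
    have h1 : ‖fderiv ℝ v x‖ ^ 2 ≤ ∑ j, ‖fderiv ℝ v x (e j)‖ ^ 2 :=
      FluidPDE.sq_opNorm_le_sum_sq_norm_apply e (fderiv ℝ v x)
    simp only
    calc (‖v x‖ * ‖fderiv ℝ v x‖) ^ 2 = ‖v x‖ ^ 2 * ‖fderiv ℝ v x‖ ^ 2 := by ring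
      _ ≤ ‖v x‖ ^ 2 * ∑ j, ‖fderiv ℝ v x (e j)‖ ^ 2 := mul_le_mul_of_nonneg_left h1 (sq_nonneg _)
      _ = ∑ j, (‖v x‖ * ‖fderiv ℝ v x (e j)‖) ^ 2 := by
          rw [Finset.mul_sum]; exact Finset.sum_congr rfl fun j _ => by ring
  -- Step 1: `∫ Σᵢ ⟪∂ᵢv, ∂ᵢW⟫ = -∫ ⟪Δv, W⟫`
  have hL := integral_sum_inner_fderiv_fderiv_eq_neg_integral_inner_laplacian hv2' hW i1 i2 i3
  -- Step 2: the pressure term vanishes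
  have hpress : ∫ x, ⟪(Δ v) x, gradient q x⟫ = 0 := by
    have hswap : (fun x => ⟪(Δ v) x, gradient q x⟫) = fun x => ⟪gradient q x, (Δ v) x⟫ :=
      funext fun x => real_inner_comm _ _
    rw [hswap]
    refine integral_inner_gradient_eq_zero_of_isDivFree_R3 hq hΔ1
      (isDivFree_laplacian_of_contDiff_three hv hdiv) (fun i => ?_) (fun i => ?_) (fun i => ?_)
    · refine integrable_of_norm_le_mul_of_lintegral_sq
        ((continuous_const.inner cΔ).mul (cdiq i)).aestronglyMeasurable c3D2 (cdiq i) l2Δ (l2diq i)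
        fun x => ?_
      rw [norm_mul]
      exact mul_le_mul ((hin i _).trans (n_Δ x)) le_rfl (norm_nonneg _) (norm_nonneg _)
    · refine integrable_of_norm_le_mul_of_lintegral_sq
        ((continuous_const.inner (cdΔ i)).mul cq).aestronglyMeasurable c3D3 cq l2dΔ hq0
        fun x => ?_
      rw [norm_mul]
      exact mul_le_mul ((hin i _).trans (n_dΔ i x)) le_rfl (norm_nonneg _) (norm_nonneg _)
    · refine integrable_of_norm_le_mul_of_lintegral_sq
        ((continuous_const.inner cΔ).mul cq).aestronglyMeasurable c3D2 cq l2Δ hq0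
        fun x => ?_
      rw [norm_mul]
      exact mul_le_mul ((hin i _).trans (n_Δ x)) le_rfl (norm_nonneg _) (norm_nonneg _)
  -- Step 3: the pointwise bound `-⟪Δv, W⟫ ≤ -(ν/2)‖Δv‖² + (2ν)⁻¹ (|v| ‖Dv‖)² + ⟪Δv, ∇q⟫`
  have hpt : ∀ x, -⟪(Δ v) x, W x⟫ ≤
      -(ν / 2) * ‖(Δ v) x‖ ^ 2 + (2 * ν)⁻¹ * (‖v x‖ * ‖fderiv ℝ v x‖) ^ 2 +
        ⟪(Δ v) x, gradient q x⟫ := by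
    intro x
    have hWx : W x = ν • (Δ v) x - FluidPDE.convect v v x - gradient q x := by
      have h : W x = ν • (Δ v) x - gradient q x - FluidPDE.convect v v x :=
        eq_sub_iff_add_eq.2 (hmom x)
      rw [h]; abel
    have hid : ⟪(Δ v) x, W x⟫ = ν * ‖(Δ v) x‖ ^ 2 - ⟪(Δ v) x, FluidPDE.convect v v x⟫ -
        ⟪(Δ v) x, gradient q x⟫ := by
      rw [hWx, inner_sub_right, inner_sub_right, inner_smul_right, real_inner_self_eq_norm_sq]
    have hN' : ‖FluidPDE.convect v v x‖ ≤ ‖v x‖ * ‖fderiv ℝ v x‖ := by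
      rw [FluidPDE.convect, mul_comm]; exact (fderiv ℝ v x).le_opNorm _
    have hinner : ⟪(Δ v) x, FluidPDE.convect v v x⟫ ≤ ‖(Δ v) x‖ * (‖v x‖ * ‖fderiv ℝ v x‖) :=
      (real_inner_le_norm _ _).trans (mul_le_mul_of_nonneg_left hN' (norm_nonneg _))
    have habs : ∀ X Y : ℝ, X * Y ≤ ν / 2 * X ^ 2 + (2 * ν)⁻¹ * Y ^ 2 := by
      intro X Y
      have h1 : 0 ≤ (2 * ν)⁻¹ * (Y - ν * X) ^ 2 := by positivity
      have e1 : (2 * ν)⁻¹ * (Y - ν * X) ^ 2 = (2 * ν)⁻¹ * Y ^ 2 - X * Y + ν / 2 * X ^ 2 := by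
        field_simp
        ring
      linarith
    have hY := habs ‖(Δ v) x‖ (‖v x‖ * ‖fderiv ℝ v x‖)
    rw [hid]
    linarith [hinner, hY]
  -- Step 4: integrate
  have iA : Integrable (fun x => -(ν / 2) * ‖(Δ v) x‖ ^ 2) volume := iΔΔ.const_mul _
  have iB' : Integrable (fun x => (2 * ν)⁻¹ * (‖v x‖ * ‖fderiv ℝ v x‖) ^ 2) volume := iP.const_mul _
  have iAB : Integrable (fun x => -(ν / 2) * ‖(Δ v) x‖ ^ 2 +
      (2 * ν)⁻¹ * (‖v x‖ * ‖fderiv ℝ v x‖) ^ 2) volume := iA.add iB'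
  have irhs : Integrable (fun x => -(ν / 2) * ‖(Δ v) x‖ ^ 2 +
      (2 * ν)⁻¹ * (‖v x‖ * ‖fderiv ℝ v x‖) ^ 2 + ⟪(Δ v) x, gradient q x⟫) volume := iAB.add iΔg
  have iΔW : Integrable (fun x => ⟪(Δ v) x, W x⟫) volume :=
    integrable_of_norm_le_mul_of_lintegral_sq (cΔ.inner cW).aestronglyMeasurable c3D2 cW l2Δ hW0
      fun x => (norm_inner_le_norm _ _).trans (mul_le_mul_of_nonneg_right (n_Δ x) (norm_nonneg _))
  have hint : ∫ x, -⟪(Δ v) x, W x⟫ ≤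
      -(ν / 2) * (∫ x, ‖(Δ v) x‖ ^ 2) + (2 * ν)⁻¹ * (∫ x, (‖v x‖ * ‖fderiv ℝ v x‖) ^ 2) +
        ∫ x, ⟪(Δ v) x, gradient q x⟫ := by
    refine (integral_mono iΔW.neg irhs hpt).trans (le_of_eq ?_)
    rw [integral_add iAB iΔg, integral_add iA iB', integral_const_mul, integral_const_mul]
  have hneg_int : ∫ x, -⟪(Δ v) x, W x⟫ = - ∫ x, ⟪(Δ v) x, W x⟫ := integral_neg _
  rw [hL, ← hneg_int]
  have hL2 : 0 ≤ ∫ x, ‖(Δ v) x‖ ^ 2 := integral_nonneg fun x => sq_nonneg _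
  have hfrob0 : 0 ≤ ∫ x, FluidPDE.frobeniusNormSq (fderiv ℝ v x) :=
    integral_nonneg fun x => FluidPDE.frobeniusNormSq_nonneg _
  -- Step 5: the Serrin bound on `(2ν)⁻¹ Σⱼ Pⱼ`
  set C : ℝ := θ * (2 * (1 - θ)) ^ ((1 - θ) / θ) * 2 ^ (-(1 / θ)) * (K : ℝ) ^ (2 * (1 - θ) / θ)
    with hC
  have hkey : (2 * ν)⁻¹ * ∑ j, P j ≤
      ν / 2 * ∑ j, R j + C * ν ^ (1 - 2 / θ) * N ^ (2 / θ) * ∑ j, a j := by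
    rcases eq_or_ne r ⊤ with hrtop | hrtop
    · -- the endpoint `r = ∞`: `Pⱼ ≤ N² aⱼ` pointwise, `θ = 1`, `C = 1/2`
      have hθ1' : θ = 1 := by rw [hθ, hrtop, ENNReal.div_top, ENNReal.toReal_zero, sub_zero]
      have hNpt : ∀ x, ‖v x‖ ≤ N := fun x => by
        rw [hNdef, hrtop]; rw [hrtop] at hvr
        exact norm_le_toReal_eLpNorm_top_of_continuous cv hvr x
      have hPj : ∀ j, P j ≤ N ^ 2 * a j := by
        intro j
        rw [hP, ha]
        simp only
        rw [← integral_const_mul]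
        refine integral_mono (i_Pj j) ((i_a j).const_mul _) fun x => ?_
        simp only
        rw [mul_pow]
        exact mul_le_mul_of_nonneg_right (pow_le_pow_left₀ (norm_nonneg _) (hNpt x) 2) (sq_nonneg _)
      rw [hC, hθ1']
      exact serrin_absorb_sum_top hν hR0 hPj
    · -- `3 < r < ∞`: per-component key estimate and Young absorption
      have hρ0 : 0 < r.toReal := ENNReal.toReal_pos hr0 hrtop
      have hθρ : θ = 1 - 3 / r.toReal := by rw [hθ, ENNReal.toReal_div, ENNReal.toReal_ofNat]
      have hθlt : θ < 1 := by
        rw [hθρ]; linarith [div_pos (zero_lt_three' ℝ) hρ0]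
      have hstep : ∀ j, (2 * ν)⁻¹ * P j ≤ ν / 2 * R j + C * ν ^ (1 - 2 / θ) * N ^ (2 / θ) * a j := by
        intro j
        have hkj := integral_sq_norm_mul_norm_fderiv_apply_le hv hv1 hv2 hB hr hrtop hvr j
        rw [← hθρ, show 3 / r.toReal = 1 - θ by rw [hθρ]; ring] at hkj
        rw [hC]
        exact serrin_absorb_component hθ0 hθlt hν hN0 K.coe_nonneg (ha0 j) (hR0 j) hkj
      calc (2 * ν)⁻¹ * ∑ j, P j = ∑ j, (2 * ν)⁻¹ * P j := Finset.mul_sum _ _ _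
        _ ≤ ∑ j, (ν / 2 * R j + C * ν ^ (1 - 2 / θ) * N ^ (2 / θ) * a j) :=
            Finset.sum_le_sum fun j _ => hstep j
        _ = ν / 2 * ∑ j, R j + C * ν ^ (1 - 2 / θ) * N ^ (2 / θ) * ∑ j, a j := by
            rw [Finset.sum_add_distrib, ← Finset.mul_sum, ← Finset.mul_sum]
  -- Step 6: conclude
  rw [hHess, hsum_a] at hkey
  have hPint : (2 * ν)⁻¹ * ∫ x, (‖v x‖ * ‖fderiv ℝ v x‖) ^ 2 ≤ (2 * ν)⁻¹ * ∑ j, P j :=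
    mul_le_mul_of_nonneg_left hPsum (by positivity)
  linarith [hint, hpress, hkey, hPint]

end Slice

/-! ### The enstrophy balance on a slab -/

section Balance

/-- **The enstrophy balance of a jointly smooth field on a closed slab** (the first equality of
Lemarié-Rieusset 2016, (7.20)/(11.9): `d/dt ∫|∇u|² = 2 Σᵢ ∫ ∂ᵢu · ∂ᵢ∂ₜu`, in integrated form).
Let `u` be jointly smooth on `[0, T] × ℝ³` with `‖D¹u(t)‖²_{L²} ≤ C₁` and `‖D¹∂ₜu(t)‖²_{L²} ≤ C₂`
on `[0, T]` (`∂ₜu` the one-sided time derivative within `[0, T]`). Then, with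
`G(t) = ∫ |∇u(t)|²_F` and `Φ(t) = ∫ 2 Σᵢ ⟪∂ᵢu(t), ∂ᵢ∂ₜu(t)⟫`: `Φ` is integrable on `(0, T)`, `G` is
continuous on `[0, T]`, and `G(b) = G(0) + ∫₀ᵇ Φ` for every `b ∈ (0, T]` (pointwise
`d/dt |∇u(t,x)|² = 2Σᵢ⟪∂ᵢu, ∂ᵢ∂ₜu⟫` at interior times, the fundamental theorem of calculus in
`t` for each `x`, and Fubini, all fields being `L^∞_t L²_x`). This is the identity used inline in
`EnstrophyGronwall.lean` and `EnstrophySplitting.lean`, isolated; no equation is involved. [folklore] -/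
theorem IsSmoothSpaceTimeOn.enstrophy_balance {T : ℝ} (hT : 0 < T)
    {u : ℝ → EuclideanSpace ℝ (Fin 3) → EuclideanSpace ℝ (Fin 3)}
    (hu : FluidPDE.IsSmoothSpaceTimeOn (Icc 0 T) u) {C₁ C₂ : ℝ≥0}
    (hC₁ : ∀ t ∈ Icc 0 T, ∫⁻ x, ‖iteratedFDeriv ℝ 1 (u t) x‖ₑ ^ 2 ≤ C₁)
    (hC₂ : ∀ t ∈ Icc 0 T,
      ∫⁻ x, ‖iteratedFDeriv ℝ 1 (FluidPDE.timeDerivWithin (Icc 0 T) u t) x‖ₑ ^ 2 ≤ C₂) :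
    IntegrableOn (fun t => ∫ x, 2 * ∑ i, ⟪fderiv ℝ (u t) x (EuclideanSpace.basisFun (Fin 3) ℝ i),
        fderiv ℝ (FluidPDE.timeDerivWithin (Icc 0 T) u t) x (EuclideanSpace.basisFun (Fin 3) ℝ i)⟫)
      (Ioo 0 T) ∧
    ContinuousOn (fun t => ∫ x, FluidPDE.frobeniusNormSq (fderiv ℝ (u t) x)) (Icc 0 T) ∧
    ∀ b ∈ Ioc 0 T, ∫ x, FluidPDE.frobeniusNormSq (fderiv ℝ (u b) x) =
      (∫ x, FluidPDE.frobeniusNormSq (fderiv ℝ (u 0) x)) +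
        ∫ t in (0 : ℝ)..b, ∫ x, 2 * ∑ i, ⟪fderiv ℝ (u t) x (EuclideanSpace.basisFun (Fin 3) ℝ i),
          fderiv ℝ (FluidPDE.timeDerivWithin (Icc 0 T) u t) x (EuclideanSpace.basisFun (Fin 3) ℝ i)⟫ := by
  set e := EuclideanSpace.basisFun (Fin 3) ℝ with he
  have hU : UniqueDiffOn ℝ (Icc 0 T) := uniqueDiffOn_Icc hT
  set W : ℝ → EuclideanSpace ℝ (Fin 3) → EuclideanSpace ℝ (Fin 3) :=
    FluidPDE.timeDerivWithin (Icc 0 T) u with hW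
  have hWsm : FluidPDE.IsSmoothSpaceTimeOn (Icc 0 T) W := hu.timeDerivWithin hU
  -- joint continuity of `D(u t)(x)` and `D(W t)(x)`
  have cDu : ContinuousOn (fun z : ℝ × EuclideanSpace ℝ (Fin 3) => fderiv ℝ (u z.1) z.2)
      (Icc 0 T ×ˢ univ) := hu.continuousOn_fderiv_slice hU
  have cDW : ContinuousOn (fun z : ℝ × EuclideanSpace ℝ (Fin 3) => fderiv ℝ (W z.1) z.2)
      (Icc 0 T ×ˢ univ) := hWsm.continuousOn_fderiv_slice hU
  -- the density `g t x = Σᵢ ⟪∂ᵢu, ∂ᵢW⟫` and the enstrophy `G t = ∫ |∇u(t)|²`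
  set g : ℝ → EuclideanSpace ℝ (Fin 3) → ℝ := fun t x =>
    ∑ i, ⟪fderiv ℝ (u t) x (e i), fderiv ℝ (W t) x (e i)⟫ with hg
  set G : ℝ → ℝ := fun t => ∫ x, FluidPDE.frobeniusNormSq (fderiv ℝ (u t) x) with hG
  have cg : ContinuousOn (uncurry g) (Icc 0 T ×ˢ univ) := by
    refine continuousOn_finsetSum _ fun i _ => ContinuousOn.inner ?_ ?_
    · exact cDu.clm_apply continuousOn_const
    · exact cDW.clm_apply continuousOn_const
  have cfrob : ContinuousOn (fun z : ℝ × EuclideanSpace ℝ (Fin 3) =>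
      FluidPDE.frobeniusNormSq (fderiv ℝ (u z.1) z.2)) (Icc 0 T ×ˢ univ) :=
    continuous_frobeniusNormSq_clm.comp_continuousOn cDu
  have hcd : ∀ t ∈ Icc 0 T, ContDiff ℝ 1 (u t) := fun t ht => (hu.contDiff_slice ht).of_le (by norm_cast)
  -- uniform `L²` bounds
  have hfrob_le : ∀ t ∈ Icc 0 T,
      ∫⁻ x, ENNReal.ofReal (FluidPDE.frobeniusNormSq (fderiv ℝ (u t) x)) ≤ 3 * C₁ := by
    intro t ht
    calc ∫⁻ x, ENNReal.ofReal (FluidPDE.frobeniusNormSq (fderiv ℝ (u t) x))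
        ≤ ∫⁻ x, 3 * ‖iteratedFDeriv ℝ 1 (u t) x‖ₑ ^ 2 := lintegral_mono fun x => by
          rw [← ofReal_norm, norm_iteratedFDeriv_one, ofReal_norm]
          exact ofReal_frobeniusNormSq_le_three_mul_enorm_sq _
      _ = 3 * ∫⁻ x, ‖iteratedFDeriv ℝ 1 (u t) x‖ₑ ^ 2 := lintegral_const_mul' _ _ (by norm_num)
      _ ≤ 3 * C₁ := by gcongr; exact hC₁ t ht
  have hfrob_lt : ∀ t ∈ Icc 0 T,
      ∫⁻ x, ENNReal.ofReal (FluidPDE.frobeniusNormSq (fderiv ℝ (u t) x)) < ⊤ := fun t ht =>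
    lt_of_le_of_lt (hfrob_le t ht) (ENNReal.mul_lt_top (by norm_num) ENNReal.coe_lt_top)
  have hDW_le : ∀ t ∈ Icc 0 T, ∫⁻ x, ‖fderiv ℝ (W t) x‖ₑ ^ 2 ≤ C₂ := fun t ht => by
    calc ∫⁻ x, ‖fderiv ℝ (W t) x‖ₑ ^ 2 = ∫⁻ x, ‖iteratedFDeriv ℝ 1 (W t) x‖ₑ ^ 2 :=
          lintegral_congr fun x => by
            rw [← ofReal_norm, ← norm_iteratedFDeriv_one, ofReal_norm]
      _ ≤ C₂ := hC₂ t ht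
  -- integrability of the slices of `|∇u|²`
  have ifrob : ∀ t ∈ Icc 0 T, Integrable (fun x => FluidPDE.frobeniusNormSq (fderiv ℝ (u t) x)) volume :=
    fun t ht => integrable_of_continuous_of_nonneg
      (FluidPDE.continuous_frobeniusNormSq_fderiv (hcd t ht) (by simp))
      (fun x => FluidPDE.frobeniusNormSq_nonneg _) (hfrob_lt t ht)
  -- pointwise bound `|g| ≤ (3/2)(‖Du‖² + ‖DW‖²)` and integrability of `g` on `(0, T) × ℝ³`
  have hgle : ∀ t x, ‖g t x‖ ≤ (3 / 2) * (‖fderiv ℝ (u t) x‖ ^ 2 + ‖fderiv ℝ (W t) x‖ ^ 2) := by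
    intro t x
    have h1 : ∀ i, ‖⟪fderiv ℝ (u t) x (e i), fderiv ℝ (W t) x (e i)⟫‖ ≤
        ‖fderiv ℝ (u t) x‖ * ‖fderiv ℝ (W t) x‖ := fun i =>
      (norm_inner_le_norm (𝕜 := ℝ) _ _).trans (mul_le_mul
        (by simpa [he] using (fderiv ℝ (u t) x).le_opNorm (e i))
        (by simpa [he] using (fderiv ℝ (W t) x).le_opNorm (e i)) (norm_nonneg _) (norm_nonneg _))
    calc ‖g t x‖ ≤ ∑ i, ‖⟪fderiv ℝ (u t) x (e i), fderiv ℝ (W t) x (e i)⟫‖ := norm_sum_le _ _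
      _ ≤ ∑ _i : Fin 3, ‖fderiv ℝ (u t) x‖ * ‖fderiv ℝ (W t) x‖ := Finset.sum_le_sum fun i _ => h1 i
      _ = 3 * (‖fderiv ℝ (u t) x‖ * ‖fderiv ℝ (W t) x‖) := by simp
      _ ≤ (3 / 2) * (‖fderiv ℝ (u t) x‖ ^ 2 + ‖fderiv ℝ (W t) x‖ ^ 2) := by
          nlinarith [sq_nonneg (‖fderiv ℝ (u t) x‖ - ‖fderiv ℝ (W t) x‖)]
  have hg_lint : ∀ t ∈ Icc 0 T, ∫⁻ x, ‖g t x‖ₑ ≤ (3 / 2 : ℝ≥0∞) * (3 * C₁ + C₂) := by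
    intro t ht
    have h32 : (3 / 2 : ℝ≥0∞) = ENNReal.ofReal (3 / 2) := by
      rw [ENNReal.ofReal_div_of_pos (by norm_num), ENNReal.ofReal_ofNat, ENNReal.ofReal_ofNat]
    have hpt : ∀ x, ‖g t x‖ₑ ≤ (3 / 2 : ℝ≥0∞) * (‖fderiv ℝ (u t) x‖ₑ ^ 2 + ‖fderiv ℝ (W t) x‖ₑ ^ 2) := by
      intro x
      have hR : (3 / 2 : ℝ≥0∞) * (‖fderiv ℝ (u t) x‖ₑ ^ 2 + ‖fderiv ℝ (W t) x‖ₑ ^ 2) =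
          ENNReal.ofReal ((3 / 2) * (‖fderiv ℝ (u t) x‖ ^ 2 + ‖fderiv ℝ (W t) x‖ ^ 2)) := by
        rw [ENNReal.ofReal_mul (by norm_num), ENNReal.ofReal_add (sq_nonneg _) (sq_nonneg _),
          ENNReal.ofReal_pow (norm_nonneg _), ENNReal.ofReal_pow (norm_nonneg _), ofReal_norm,
          ofReal_norm, h32]
      rw [hR, ← ofReal_norm]
      exact ENNReal.ofReal_le_ofReal (hgle t x)
    calc ∫⁻ x, ‖g t x‖ₑ ≤ ∫⁻ x, (3 / 2 : ℝ≥0∞) * (‖fderiv ℝ (u t) x‖ₑ ^ 2 + ‖fderiv ℝ (W t) x‖ₑ ^ 2) :=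
          lintegral_mono hpt
      _ = (3 / 2 : ℝ≥0∞) * ((∫⁻ x, ‖fderiv ℝ (u t) x‖ₑ ^ 2) + ∫⁻ x, ‖fderiv ℝ (W t) x‖ₑ ^ 2) := by
          rw [lintegral_const_mul' _ _ (ENNReal.div_ne_top (by simp) (by simp)), lintegral_add_left']
          exact ((hcd t ht).continuous_fderiv (by simp)).aemeasurable.enorm.pow_const _
      _ ≤ (3 / 2 : ℝ≥0∞) * (3 * C₁ + C₂) := by
          gcongr
          · calc ∫⁻ x, ‖fderiv ℝ (u t) x‖ₑ ^ 2
                ≤ ∫⁻ x, ENNReal.ofReal (FluidPDE.frobeniusNormSq (fderiv ℝ (u t) x)) :=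
                  lintegral_mono fun _ => enorm_sq_fderiv_le_ofReal_frobeniusNormSq _
              _ ≤ 3 * C₁ := hfrob_le t ht
          · exact hDW_le t ht
  have h32ne : (3 / 2 : ℝ≥0∞) ≠ ⊤ := ENNReal.div_ne_top (by simp) (by simp)
  have hKfin : (3 / 2 : ℝ≥0∞) * (3 * C₁ + C₂) ≠ ⊤ :=
    ENNReal.mul_ne_top h32ne
      (ENNReal.add_ne_top.2 ⟨ENNReal.mul_ne_top (by norm_num) ENNReal.coe_ne_top, ENNReal.coe_ne_top⟩)
  have hg_int : ∀ b ∈ Ioc 0 T, Integrable (uncurry g)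
      (((volume : Measure ℝ).restrict (Ioo 0 b)).prod volume) := by
    intro b hb
    refine FluidPDE.integrable_prod_of_continuousOn_of_lintegral
      (cg.mono (prod_mono (Icc_subset_Icc le_rfl hb.2) Subset.rfl)) ?_
    calc ∫⁻ t in Ioo 0 b, ∫⁻ x, ‖uncurry g (t, x)‖ₑ
        ≤ ∫⁻ _ in Ioo 0 b, (3 / 2 : ℝ≥0∞) * (3 * C₁ + C₂) :=
          setLIntegral_mono' measurableSet_Ioo fun t ht =>
            hg_lint t ⟨ht.1.le, ht.2.le.trans hb.2⟩
      _ < ⊤ := by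
          rw [setLIntegral_const]
          exact ENNReal.mul_lt_top hKfin.lt_top (by simp)
  -- the time derivative of `|∇u(t, x)|²` at interior times
  have hderiv : ∀ t ∈ Ioo 0 T, ∀ x, HasDerivAt (fun τ => FluidPDE.frobeniusNormSq (fderiv ℝ (u τ) x))
      (2 * g t x) t := fun t ht x =>
    hasDerivAt_frobeniusNormSq (hu.hasDerivAt_fderiv_slice_timeDerivWithin
      isOpen_Ioo Ioo_subset_Icc_self ht x)
  -- FTC in `t` for each `x`, on `[0, b]`
  have hFTC : ∀ b ∈ Ioc 0 T, ∀ x, ∫ t in (0 : ℝ)..b, 2 * g t x =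
      FluidPDE.frobeniusNormSq (fderiv ℝ (u b) x) - FluidPDE.frobeniusNormSq (fderiv ℝ (u 0) x) := by
    intro b hb x
    have hsub : Icc 0 b ⊆ Icc 0 T := Icc_subset_Icc le_rfl hb.2
    have hc : ContinuousOn (fun τ => ((τ, x) : ℝ × EuclideanSpace ℝ (Fin 3))) (Icc 0 b) :=
      (continuous_id.prodMk continuous_const).continuousOn
    have hmaps : MapsTo (fun τ => ((τ, x) : ℝ × EuclideanSpace ℝ (Fin 3))) (Icc 0 b)
        (Icc 0 T ×ˢ univ) := fun τ hτ => mk_mem_prod (hsub hτ) (mem_univ x)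
    have hcont : ContinuousOn (fun τ => FluidPDE.frobeniusNormSq (fderiv ℝ (u τ) x)) (Icc 0 b) :=
      (cfrob.comp hc hmaps).congr fun τ _ => rfl
    have hcg : ContinuousOn (fun τ => g τ x) (Icc 0 b) := (cg.comp hc hmaps).congr fun τ _ => rfl
    have hcont' : ContinuousOn (fun τ => 2 * g τ x) (Icc 0 b) := continuousOn_const.mul hcg
    exact intervalIntegral.integral_eq_sub_of_hasDerivAt_of_le
      (f := fun τ => FluidPDE.frobeniusNormSq (fderiv ℝ (u τ) x)) (f' := fun τ => 2 * g τ x) hb.1.le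
      hcont (fun t ht => hderiv t ⟨ht.1, ht.2.trans_le hb.2⟩ x)
      (hcont'.intervalIntegrable_of_Icc hb.1.le)
  -- Fubini: `G b - G 0 = ∫₀ᵇ ∫ 2 g`
  set φ : ℝ → ℝ := fun t => ∫ x, 2 * g t x with hφ
  have hφ_int : IntegrableOn φ (Ioo 0 T) volume :=
    ((hg_int T ⟨hT, le_rfl⟩).const_mul 2).integral_prod_left
  have hGb : ∀ b ∈ Ioc 0 T, G b = G 0 + ∫ t in (0 : ℝ)..b, φ t := by
    intro b hb
    have hI := (hg_int b hb).const_mul 2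
    have hswap := integral_integral_swap (μ := (volume : Measure ℝ).restrict (Ioo 0 b))
      (ν := (volume : Measure (EuclideanSpace ℝ (Fin 3)))) (f := fun t x => 2 * g t x) hI
    have hx : ∫ x, ∫ t in Ioo 0 b, 2 * g t x = G b - G 0 := by
      have : (fun x => ∫ t in Ioo 0 b, 2 * g t x) = fun x =>
          FluidPDE.frobeniusNormSq (fderiv ℝ (u b) x) - FluidPDE.frobeniusNormSq (fderiv ℝ (u 0) x) := by
        funext x
        rw [← hFTC b hb x, intervalIntegral.integral_of_le hb.1.le, integral_Ioc_eq_integral_Ioo]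
      rw [this, integral_sub (ifrob b ⟨hb.1.le, hb.2⟩) (ifrob 0 ⟨le_rfl, hT.le⟩)]
    rw [intervalIntegral.integral_of_le hb.1.le, integral_Ioc_eq_integral_Ioo, hφ]
    simp only
    rw [hswap, hx]
    ring
  -- continuity of `G` on `[0, T]`
  have hGcont : ContinuousOn G (Icc 0 T) := by
    have hprim : ContinuousOn (fun b => ∫ t in (0 : ℝ)..b, φ t) (Icc 0 T) := by
      have h := intervalIntegral.continuousOn_primitive_interval (μ := volume) (f := φ) (a := 0)
        (b := T) (by
          rw [uIcc_of_le hT.le]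
          exact (hφ_int.congr_set_ae Ioo_ae_eq_Icc.symm))
      rwa [uIcc_of_le hT.le] at h
    have heq : ∀ b ∈ Icc 0 T, G b = G 0 + ∫ t in (0 : ℝ)..b, φ t := by
      intro b hb
      rcases eq_or_lt_of_le hb.1 with h | h
      · rw [← h]; simp
      · exact hGb b ⟨h, hb.2⟩
    exact (continuousOn_const.add hprim).congr heq
  refine ⟨?_, hGcont, hGb⟩
  refine hφ_int.congr_fun (fun t _ => ?_) measurableSet_Ioo
  simp only [hφ, hg]

end Balance

/-! ### Serrin's enstrophy inequality on a slab -/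

section Slab

/-- **Serrin's enstrophy inequality** (Lemarié-Rieusset 2016, Thm. 11.2, (11.11) with `f = 0`:
"`‖u(T)‖²_{Ḣ¹} ≤ ‖u₀‖²_{Ḣ¹} e^{C₀ ν^{1-p} ∫₀ᵀ ‖u‖_q^p dt}`, `2/p + 3/q = 1`, `2 ≤ p < ∞`"; the
computation of Robinson–Rodrigo–Sadowski 2016, proof of Lemma 8.16, "the Gronwall Lemma implies
`‖∇u(t)‖² ≤ ‖∇u(0)‖² exp(∫₀ᵗ ‖u(s)‖^r_{L^s} ds)`"). Let `(u, p)` be a classical solution of the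
unforced Navier–Stokes system with viscosity `ν > 0` on the closed slab `[0, T] × ℝ³` such that `u`,
`∂ₜu` (the one-sided time derivative within `[0, T]`) and `p` have all `L²` Sobolev norms bounded on
`[0, T]` (the class of Tao 2013, Thm. 5.4 (iv); orders `≤ 3`, `≤ 1`, `≤ 1` are used). Let
`3 < r ≤ ∞`, `θ = 1 - (3/r).toReal` (so `q = 2/θ = 2r/(r-3) ∈ [2, ∞)`, `2/q + 3/r = 1`), and
`0 < s ≤ T` with `A = ∫₀ˢ ‖u(t)‖_{L^r}^q dt < ∞` (lower integral of
`ofReal ((eLpNorm (u t) r).toReal ^ q)`). Then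
`∫ |∇u(s)|² ≤ exp (2 C(θ) ν^{1-q} A) ∫ |∇u(0)|²`, `C(θ) = θ (2(1-θ))^{(1-θ)/θ} 2^{-1/θ} K^{2(1-θ)/θ}`.
Proof: the balance `IsSmoothSpaceTimeOn.enstrophy_balance`, the slice bound
`integral_sum_inner_fderiv_le_of_momentum_of_eLpNorm` at every interior time (each slice is bounded,
`linfty_bound_of_hasBoundedSobolevNormsOn_holds`, and in `L²`, hence in `L^r`), and Grönwall's lemma
`lintegral_gronwall_le` applied to `ofReal ∘ G`. [cite: LemarieRieusset2016, Thm. 11.2 (11.11)] -/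
theorem serrin_enstrophy_le_mul_exp {ν T : ℝ} (hν : 0 < ν) (hT : 0 < T)
    {u : ℝ → EuclideanSpace ℝ (Fin 3) → EuclideanSpace ℝ (Fin 3)}
    {p : ℝ → EuclideanSpace ℝ (Fin 3) → ℝ} (hsol : FluidPDE.IsClassicalNSSolutionOn (Icc 0 T) ν 0 u p)
    (hu : HasBoundedSobolevNormsOn (Icc 0 T) u)
    (hut : HasBoundedSobolevNormsOn (Icc 0 T) (FluidPDE.timeDerivWithin (Icc 0 T) u))
    (hp : ∀ n : ℕ, ∃ C : ℝ≥0, ∀ t ∈ Icc 0 T, ∫⁻ x, ‖iteratedFDeriv ℝ n (p t) x‖ₑ ^ 2 ≤ C)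
    {r : ℝ≥0∞} (hr : 3 < r) {θ : ℝ} (hθ : θ = 1 - (3 / r).toReal) {s : ℝ} (hs : s ∈ Ioc 0 T)
    (hA : ∫⁻ t in Ioo 0 s, ENNReal.ofReal ((eLpNorm (u t) r volume).toReal ^ (2 / θ)) ≠ ⊤) :
    ∫⁻ x, ENNReal.ofReal (FluidPDE.frobeniusNormSq (fderiv ℝ (u s) x)) ≤
      ENNReal.ofReal (Real.exp (2 * (θ * (2 * (1 - θ)) ^ ((1 - θ) / θ) * 2 ^ (-(1 / θ)) *
          (SNormLESNormFDerivOfEqConst (EuclideanSpace ℝ (Fin 3))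
            (volume : Measure (EuclideanSpace ℝ (Fin 3))) 2 : ℝ) ^ (2 * (1 - θ) / θ)) *
          ν ^ (1 - 2 / θ) *
          (∫⁻ t in Ioo 0 s, ENNReal.ofReal ((eLpNorm (u t) r volume).toReal ^ (2 / θ))).toReal)) *
        ∫⁻ x, ENNReal.ofReal (FluidPDE.frobeniusNormSq (fderiv ℝ (u 0) x)) := by
  set e := EuclideanSpace.basisFun (Fin 3) ℝ with he
  set K : ℝ≥0 := SNormLESNormFDerivOfEqConst (EuclideanSpace ℝ (Fin 3))
    (volume : Measure (EuclideanSpace ℝ (Fin 3))) 2 with hK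
  set C : ℝ := θ * (2 * (1 - θ)) ^ ((1 - θ) / θ) * 2 ^ (-(1 / θ)) * (K : ℝ) ^ (2 * (1 - θ) / θ)
    with hC
  have hU : UniqueDiffOn ℝ (Icc 0 T) := uniqueDiffOn_Icc hT
  set W : ℝ → EuclideanSpace ℝ (Fin 3) → EuclideanSpace ℝ (Fin 3) :=
    FluidPDE.timeDerivWithin (Icc 0 T) u with hW
  have hWsm : FluidPDE.IsSmoothSpaceTimeOn (Icc 0 T) W := hsol.smooth_velocity.timeDerivWithin hU
  -- the exponent
  have hr0 : r ≠ 0 := (lt_trans (by norm_num) hr).ne'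
  have h3r : (3 / r).toReal < 1 := by
    rcases eq_or_ne r ⊤ with hrtop | hrtop
    · rw [hrtop, ENNReal.div_top, ENNReal.toReal_zero]; exact zero_lt_one
    · have hρ3 : 3 < r.toReal := by
        rw [← ENNReal.toReal_ofNat 3]; exact (ENNReal.toReal_lt_toReal (by norm_num) hrtop).2 hr
      rw [ENNReal.toReal_div, ENNReal.toReal_ofNat, div_lt_one (by linarith)]
      exact hρ3
  have hθ0 : 0 < θ := by rw [hθ]; linarith
  have hθ1 : θ ≤ 1 := by rw [hθ]; linarith [ENNReal.toReal_nonneg (a := 3 / r)]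
  have hC0 : 0 ≤ C := by
    have : 0 ≤ 1 - θ := by linarith
    positivity
  -- a pointwise bound on `u` over the slab (Sobolev), and `u(t) ∈ L^r`
  obtain ⟨B₀, hB₀⟩ := linfty_bound_of_hasBoundedSobolevNormsOn_holds
    (fun t ht => (hsol.contDiff_velocity ht).of_le (by norm_cast)) hu
  have hB₀0 : 0 ≤ B₀ := (norm_nonneg _).trans (hB₀ 0 ⟨le_rfl, hT.le⟩ 0)
  obtain ⟨C₀, hC₀⟩ := hu 0
  obtain ⟨C₁, hC₁⟩ := hu 1
  obtain ⟨D₂, hD₂⟩ := hu 2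
  obtain ⟨D₃, hD₃⟩ := hu 3
  obtain ⟨E₀, hE₀⟩ := hut 0
  obtain ⟨E₁, hE₁⟩ := hut 1
  obtain ⟨P₀, hP₀⟩ := hp 0
  obtain ⟨P₁, hP₁⟩ := hp 1
  have hzero : ∀ {f : EuclideanSpace ℝ (Fin 3) → EuclideanSpace ℝ (Fin 3)} {C' : ℝ≥0},
      (∫⁻ x, ‖iteratedFDeriv ℝ 0 f x‖ₑ ^ 2 ≤ C') → ∫⁻ x, ‖f x‖ₑ ^ 2 < ⊤ := by
    intro f C' h
    refine lt_of_le_of_lt ((le_of_eq (lintegral_congr fun x => ?_)).trans h) ENNReal.coe_lt_top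
    rw [← ofReal_norm, ← ofReal_norm, norm_iteratedFDeriv_zero]
  have hzero' : ∀ {f : EuclideanSpace ℝ (Fin 3) → ℝ} {C' : ℝ≥0},
      (∫⁻ x, ‖iteratedFDeriv ℝ 0 f x‖ₑ ^ 2 ≤ C') → ∫⁻ x, ‖f x‖ₑ ^ 2 < ⊤ := by
    intro f C' h
    refine lt_of_le_of_lt ((le_of_eq (lintegral_congr fun x => ?_)).trans h) ENNReal.coe_lt_top
    rw [← ofReal_norm, ← ofReal_norm, norm_iteratedFDeriv_zero]
  have hLr : ∀ t ∈ Icc 0 T, eLpNorm (u t) r volume < ⊤ := fun t ht =>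
    eLpNorm_lt_top_of_bound_of_two hB₀0 (hB₀ t ht) (hzero (hC₀ t ht)) (le_trans (by norm_num) hr.le)
  -- the enstrophy balance
  obtain ⟨hΦint, hGcont, hGb⟩ := hsol.smooth_velocity.enstrophy_balance hT hC₁ hE₁
  set Φ : ℝ → ℝ := fun t => ∫ x, 2 * ∑ i, ⟪fderiv ℝ (u t) x (e i), fderiv ℝ (W t) x (e i)⟫ with hΦ
  set G : ℝ → ℝ := fun t => ∫ x, FluidPDE.frobeniusNormSq (fderiv ℝ (u t) x) with hG
  have hG0 : ∀ t, 0 ≤ G t := fun t => integral_nonneg fun x => FluidPDE.frobeniusNormSq_nonneg _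
  have hfrob_le : ∀ t ∈ Icc 0 T,
      ∫⁻ x, ENNReal.ofReal (FluidPDE.frobeniusNormSq (fderiv ℝ (u t) x)) ≤ 3 * C₁ := by
    intro t ht
    calc ∫⁻ x, ENNReal.ofReal (FluidPDE.frobeniusNormSq (fderiv ℝ (u t) x))
        ≤ ∫⁻ x, 3 * ‖iteratedFDeriv ℝ 1 (u t) x‖ₑ ^ 2 := lintegral_mono fun x => by
          rw [← ofReal_norm, norm_iteratedFDeriv_one, ofReal_norm]
          exact ofReal_frobeniusNormSq_le_three_mul_enorm_sq _
      _ = 3 * ∫⁻ x, ‖iteratedFDeriv ℝ 1 (u t) x‖ₑ ^ 2 := lintegral_const_mul' _ _ (by norm_num)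
      _ ≤ 3 * C₁ := by gcongr; exact hC₁ t ht
  have hfrob_lt : ∀ t ∈ Icc 0 T,
      ∫⁻ x, ENNReal.ofReal (FluidPDE.frobeniusNormSq (fderiv ℝ (u t) x)) < ⊤ := fun t ht =>
    lt_of_le_of_lt (hfrob_le t ht) (ENNReal.mul_lt_top (by norm_num) ENNReal.coe_lt_top)
  have ifrob : ∀ t ∈ Icc 0 T, Integrable (fun x => FluidPDE.frobeniusNormSq (fderiv ℝ (u t) x)) volume :=
    fun t ht => integrable_of_continuous_of_nonneg
      (FluidPDE.continuous_frobeniusNormSq_fderiv (hsol.contDiff_velocity ht) (by simp))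
      (fun x => FluidPDE.frobeniusNormSq_nonneg _) (hfrob_lt t ht)
  have hGeq : ∀ t ∈ Icc 0 T, ENNReal.ofReal (G t) =
      ∫⁻ x, ENNReal.ofReal (FluidPDE.frobeniusNormSq (fderiv ℝ (u t) x)) := fun t ht =>
    ofReal_integral_eq_lintegral_ofReal (ifrob t ht)
      (Eventually.of_forall fun x => FluidPDE.frobeniusNormSq_nonneg _)
  -- the Serrin production bound at interior times: `Φ t ≤ κ t * G t`
  set Nq : ℝ → ℝ := fun t => (eLpNorm (u t) r volume).toReal ^ (2 / θ) with hNq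
  have hNq0 : ∀ t, 0 ≤ Nq t := fun t => Real.rpow_nonneg ENNReal.toReal_nonneg _
  have hslice : ∀ t ∈ Ioo 0 T, Φ t ≤ 2 * C * ν ^ (1 - 2 / θ) * Nq t * G t := by
    intro t ht
    have htI : t ∈ Icc 0 T := Ioo_subset_Icc_self ht
    have hmom : ∀ x, W t x + FluidPDE.convect (u t) (u t) x = ν • (Δ (u t)) x - gradient (p t) x := by
      intro x
      have h := hsol.momentum t htI x
      simpa [hW] using h
    have hsl := integral_sum_inner_fderiv_le_of_momentum_of_eLpNorm hν
      ((hsol.contDiff_velocity htI).of_le (by norm_cast))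
      ((hWsm.contDiff_slice htI).of_le (by norm_cast))
      ((hsol.contDiff_pressure htI).of_le (by norm_cast)) hmom (hsol.divFree t htI)
      (fun x => hB₀ t htI x) hr (hLr t htI) hθ
      ((hC₁ t htI).trans_lt ENNReal.coe_lt_top) ((hD₂ t htI).trans_lt ENNReal.coe_lt_top)
      ((hD₃ t htI).trans_lt ENNReal.coe_lt_top)
      (hzero (hE₀ t htI)) ((hE₁ t htI).trans_lt ENNReal.coe_lt_top)
      (hzero' (hP₀ t htI)) ((hP₁ t htI).trans_lt ENNReal.coe_lt_top)
    have h2 : Φ t = 2 * ∫ x, ∑ i, ⟪fderiv ℝ (u t) x (e i), fderiv ℝ (W t) x (e i)⟫ := by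
      rw [hΦ]
      exact integral_const_mul _ _
    rw [h2]
    have := mul_le_mul_of_nonneg_left hsl (zero_le_two (α := ℝ))
    refine this.trans_eq ?_
    simp only [hC, hNq, hG, hK]
    ring
  -- Grönwall in `ℝ≥0∞`
  set φE : ℝ → ℝ≥0∞ := fun t => ENNReal.ofReal (G t) with hφE
  set κ : ℝ := 2 * C * ν ^ (1 - 2 / θ) with hκ
  have hκ0 : 0 ≤ κ := by positivity
  set aE : ℝ → ℝ≥0∞ := fun t => ENNReal.ofReal κ * ENNReal.ofReal (Nq t) with haE
  have hM : ∀ t ∈ Icc 0 s, φE t ≤ 3 * C₁ := fun t ht => by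
    rw [hφE]; simp only; rw [hGeq t ⟨ht.1, ht.2.trans hs.2⟩]
    exact hfrob_le t ⟨ht.1, ht.2.trans hs.2⟩
  have haS : ∫⁻ t in Ioo 0 s, aE t ≠ ⊤ := by
    rw [haE]; simp only
    rw [lintegral_const_mul' _ _ ENNReal.ofReal_ne_top]
    exact ENNReal.mul_ne_top ENNReal.ofReal_ne_top hA
  have hineq : ∀ t ∈ Icc 0 s, φE t ≤ φE 0 + ∫⁻ τ in Ioo 0 t, aE τ * φE τ := by
    intro t ht
    rcases eq_or_lt_of_le ht.1 with h0 | ht0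
    · rw [← h0]; simp
    have htT : t ∈ Ioc 0 T := ⟨ht0, ht.2.trans hs.2⟩
    -- `ofReal (∫ Φ) ≤ ∫⁻ ofReal Φ ≤ ∫⁻ a φ`
    have hΦt : IntegrableOn Φ (Ioo 0 t) volume := hΦint.mono_set (Ioo_subset_Ioo le_rfl htT.2)
    have h1 : ENNReal.ofReal (∫ τ in Ioo 0 t, Φ τ) ≤ ∫⁻ τ in Ioo 0 t, ENNReal.ofReal (Φ τ) := by
      calc ENNReal.ofReal (∫ τ in Ioo 0 t, Φ τ) ≤ ENNReal.ofReal (∫ τ in Ioo 0 t, max (Φ τ) 0) :=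
            ENNReal.ofReal_le_ofReal (integral_mono hΦt hΦt.pos_part fun τ => le_max_left _ _)
        _ = ∫⁻ τ in Ioo 0 t, ENNReal.ofReal (max (Φ τ) 0) :=
            ofReal_integral_eq_lintegral_ofReal hΦt.pos_part (Eventually.of_forall fun τ => le_max_right _ _)
        _ = ∫⁻ τ in Ioo 0 t, ENNReal.ofReal (Φ τ) := lintegral_congr fun τ => by
            rcases le_total (Φ τ) 0 with h | h
            · rw [max_eq_right h, ENNReal.ofReal_zero, ENNReal.ofReal_of_nonpos h]
            · rw [max_eq_left h]
    have h2 : ∫⁻ τ in Ioo 0 t, ENNReal.ofReal (Φ τ) ≤ ∫⁻ τ in Ioo 0 t, aE τ * φE τ := by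
      refine setLIntegral_mono' measurableSet_Ioo fun τ hτ => ?_
      have hτT : τ ∈ Ioo 0 T := ⟨hτ.1, hτ.2.trans_le htT.2⟩
      calc ENNReal.ofReal (Φ τ) ≤ ENNReal.ofReal (κ * Nq τ * G τ) :=
            ENNReal.ofReal_le_ofReal (by simpa [hκ, mul_assoc] using hslice τ hτT)
        _ = aE τ * φE τ := by
            rw [haE, hφE]; simp only
            rw [ENNReal.ofReal_mul (mul_nonneg hκ0 (hNq0 τ)), ENNReal.ofReal_mul hκ0]
    calc φE t = ENNReal.ofReal (G 0 + ∫ τ in (0 : ℝ)..t, Φ τ) := by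
          rw [hφE]; simp only; congr 1; exact hGb t htT
      _ ≤ ENNReal.ofReal (G 0) + ENNReal.ofReal (∫ τ in (0 : ℝ)..t, Φ τ) := ENNReal.ofReal_add_le
      _ = φE 0 + ENNReal.ofReal (∫ τ in Ioo 0 t, Φ τ) := by
          rw [intervalIntegral.integral_of_le ht.1, integral_Ioc_eq_integral_Ioo]
      _ ≤ φE 0 + ∫⁻ τ in Ioo 0 t, aE τ * φE τ := by gcongr; exact h1.trans h2
  have hgron := lintegral_gronwall_le (S := s) ENNReal.ofReal_ne_top
    (ENNReal.mul_ne_top (by norm_num) ENNReal.coe_ne_top) hM haS hineq s ⟨hs.1.le, le_rfl⟩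
  -- unpack
  have hint_a : (∫⁻ τ in Ioo 0 s, aE τ).toReal =
      κ * (∫⁻ t in Ioo 0 s, ENNReal.ofReal (Nq t)).toReal := by
    rw [haE]; simp only
    rw [lintegral_const_mul' _ _ ENNReal.ofReal_ne_top, ENNReal.toReal_mul, ENNReal.toReal_ofReal hκ0]
  rw [hint_a] at hgron
  rw [← hGeq s ⟨hs.1.le, hs.2⟩, ← hGeq 0 ⟨le_rfl, hT.le⟩, mul_comm]
  convert hgron using 3

/-- **Serrin's enstrophy inequality, packaged**: for every `3 < r ≤ ∞` there is a constant
`C ≥ 0` (depending only on `r`) such that for every classical solution of the unforced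
Navier–Stokes system on a closed slab `[0, T] × ℝ³` in Tao's `L²`-Sobolev class and every
`0 < s ≤ T` with `A = ∫₀ˢ ‖u(t)‖_{L^r}^q dt < ∞`, `q = 2/(1 - (3/r).toReal)`,
`∫ |∇u(s)|² ≤ exp (C ν^{1-q} A) ∫ |∇u(0)|²` (Lemarié-Rieusset 2016, Thm. 11.2, (11.11): "the
constant `C₀` does not depend on `T`"; Robinson–Rodrigo–Sadowski 2016, proof of Lemma 8.16).
[cite: LemarieRieusset2016, Thm. 11.2 (11.11)] -/
theorem serrin_enstrophy_bound {r : ℝ≥0∞} (hr : 3 < r) :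
    ∃ C : ℝ, 0 ≤ C ∧ ∀ {ν T : ℝ} (_ : 0 < ν) (_ : 0 < T)
      {u : ℝ → EuclideanSpace ℝ (Fin 3) → EuclideanSpace ℝ (Fin 3)}
      {p : ℝ → EuclideanSpace ℝ (Fin 3) → ℝ} (_ : FluidPDE.IsClassicalNSSolutionOn (Icc 0 T) ν 0 u p)
      (_ : HasBoundedSobolevNormsOn (Icc 0 T) u)
      (_ : HasBoundedSobolevNormsOn (Icc 0 T) (FluidPDE.timeDerivWithin (Icc 0 T) u))
      (_ : ∀ n : ℕ, ∃ C' : ℝ≥0, ∀ t ∈ Icc 0 T, ∫⁻ x, ‖iteratedFDeriv ℝ n (p t) x‖ₑ ^ 2 ≤ C')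
      {s : ℝ} (_ : s ∈ Ioc 0 T)
      (_ : ∫⁻ t in Ioo 0 s, ENNReal.ofReal
        ((eLpNorm (u t) r volume).toReal ^ (2 / (1 - (3 / r).toReal))) ≠ ⊤),
      ∫⁻ x, ENNReal.ofReal (FluidPDE.frobeniusNormSq (fderiv ℝ (u s) x)) ≤
        ENNReal.ofReal (Real.exp (C * ν ^ (1 - 2 / (1 - (3 / r).toReal)) *
            (∫⁻ t in Ioo 0 s, ENNReal.ofReal
              ((eLpNorm (u t) r volume).toReal ^ (2 / (1 - (3 / r).toReal)))).toReal)) *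
          ∫⁻ x, ENNReal.ofReal (FluidPDE.frobeniusNormSq (fderiv ℝ (u 0) x)) := by
  set θ : ℝ := 1 - (3 / r).toReal with hθ
  set K : ℝ≥0 := SNormLESNormFDerivOfEqConst (EuclideanSpace ℝ (Fin 3))
    (volume : Measure (EuclideanSpace ℝ (Fin 3))) 2 with hK
  -- `0 < θ ≤ 1`
  have hr0 : r ≠ 0 := (lt_trans (by norm_num) hr).ne'
  have h3r : (3 / r).toReal < 1 := by
    rcases eq_or_ne r ⊤ with hrtop | hrtop
    · rw [hrtop, ENNReal.div_top, ENNReal.toReal_zero]; exact zero_lt_one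
    · have hρ3 : 3 < r.toReal := by
        rw [← ENNReal.toReal_ofNat 3]; exact (ENNReal.toReal_lt_toReal (by norm_num) hrtop).2 hr
      rw [ENNReal.toReal_div, ENNReal.toReal_ofNat, div_lt_one (by linarith)]
      exact hρ3
  have hθ0 : 0 < θ := by rw [hθ]; linarith
  have hθ1 : 0 ≤ 1 - θ := by rw [hθ]; linarith [ENNReal.toReal_nonneg (a := 3 / r)]
  refine ⟨2 * (θ * (2 * (1 - θ)) ^ ((1 - θ) / θ) * 2 ^ (-(1 / θ)) * (K : ℝ) ^ (2 * (1 - θ) / θ)),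
    by positivity, ?_⟩
  intro ν T hν hT u p hsol hu hut hp s hs hA
  have h := serrin_enstrophy_le_mul_exp hν hT hsol hu hut hp hr hθ hs hA
  simpa only [mul_assoc] using h

end Slab

end Literature.Analysis.FluidPDE

end
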